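import Summits.ValiantsHypothesis.ValiantsHypothesis.Theorems.NNDivisionHard.Negative.WeakReliefBlindPermutahedron
import Literature.Barriers.PneNP.TSPExtensionComplexityKaibelWeltge
import Literature.Combinatorics.Optimization.PatternMatrixRankUpperBounds

/-!
# AsymmetricWindow39 (REV 2) — the λ = 0 slice endpoint, λ-monotonicity, the located neighbourhood, and the
# hash-rectangle caps (PROPOSITIONS H, H′: every located hyperplane witness is T3-strength) of the located permutahedron pencil
# (crux `FifoMatching.NNDivisionHard`, stmt-ValiantsHypothesis-21181; W7 S2 lane, val-idea-39 g6)

S2 census object (R331 (2)(d)): the located permutahedron pencil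
`M_λ[a; (b, π)] = (1 − |a ∩ b|)² + λ·inv(a; π)`, `inv(a;π) = #{(l ∈ a, l′ ∉ a) : π(l′) < π(l)}`
(rows `a ⊆ [n]`, columns `(b, π)`), in the poly currency.  Kernel state before this file
(`Cruxes/NNDivisionHard/RealLambda39.lean` rev 6, port `…Negative.RealLambda*`): T1 `rank₊ M_λ ≤ n^{O(1/λ)}`
(blind unless `λ → 0`), T2/T3 `rank₊ M_λ ≥ 2^{Ω(min(n, λ^{-1/2}))}` (visible once `λ·log² n → 0`),
T4 symmetric certificates `n^{Θ(min(n,1/λ))}` (visible iff `λ → 0`).  The ASYMMETRIC WINDOW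
`λ(n) ∈ [c/log² n, o(1)]` for general factorisations is open.

THIS FILE adds four kernel facts that frame the window (memo `AsymmetricWindow39.md` has the analysis):

* §1 **Sliced Kaibel–Weltge (the λ = 0 endpoint on every slice).**  Any nonnegative factorisation of
  `((1 − |a∩b|)²)` restricted to the rows `|a| = k` (all columns `b`) has at least `C(n,k)/2^k` slots
  (`choose_le_card_mul_two_pow_of_slice_block`), although its rank is `≤ 1 + n + C(n,2)` for every `k`.
  So at `λ = 0` every slice `k` is visible with the full exponent `k` (support genus); the window question is
  how fast the exponent decays from `k` (λ = 0) to `O(1/λ)` (T1) as the located flood `λ·inv` is switched on.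
* §2 **Monotonicity in λ.**  `inv` is an explicit cone term with `n²` slots
  (`inv(a;π) = Σ_{l,l′} [l ∈ a][l′ ∉ a]·[π(l′) < π(l)]`), hence
  `HasNonnegFactorization M_{λ′} r → HasNonnegFactorization M_λ (r + n²)` for `λ′ ≤ λ`
  (`pencilEntry_factorization_mono`): lower bounds transfer DOWNWARD in `λ`, upper bounds UPWARD, and the
  visibility threshold `λ*(n, r) = sup {λ : rank₊ M_λ^{(n)} > r}` is well defined up to the additive `n²`.
* §3 **The located neighbourhood.**  Per column `π` and slice `k ≤ n`, at most `((w+1)^{√w})²` rows have flood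
  `inv(a;π) ≤ w` (`card_informative_rows_le`): a row with small flood is an initial segment of `π` up to `√w` defects
  on each side (`informative_row_structure`).  With `w ≍ 1/λ` this is the `2^{Õ(λ^{-1/2})}` cluster size behind T3.
* §4 **PROPOSITION H — the hash-rectangle cap (a typed witness CLASS, capped in kernel).**  CLASS D = weights `W` on
  slice-rows × columns vanishing off the near entries (`inv ≤ w`) and `≥ 0` on near entries of intersection level
  `|a∩b| ≠ 1` (the genus of Kaibel–Weltge / Razborov / BFPS Thm 5, hence of T2/T3, however glued across clusters).
  `hash_rectangle_cap` (abstract: any pairwise-good hash family) and `located_disjointness_witness_cap` (the pencil, linear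
  hashes `Σ_{x∈a} ω(x) = c₀ (mod q)`, counted exactly in `hash_count_one/two`): some hash rectangle `u vᵀ ≤ M_λ` earns
  `s·Σ⁺ ≤ 2q·⟨W, u vᵀ⟩` with `s = min(1, λ(w+1))`, `q = 2((w+1)^{√w})²`; with `witness_value_le` the hyperplane bound of
  every CLASS-D witness is `≤ 2q·M⁺/s = 2^{O(√w log w)}·M⁺` for `w ≥ 1/λ − 1`, `M⁺ ≤ n²` (`≤ w` on the canonical clusters) — no
  `n^{f(λ)}`.  **PROPOSITION H′** (`hash_carrier_cap`, `located_witness_cap`) removes the sign condition: EVERY weight `W` supported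
  on the near entries of the slice (any sign pattern across intersection levels) has a feasible rectangle with
  `s·⟨W, M_λ⟩ ≤ 4q(n+1)²·⟨W, u vᵀ⟩` — the hashed unit carrier pays the `(1−t)²` part, a hashed INVERSION carrier
  `λ[l∈a][l′∉a] ⊗ [π(l′)<π(l)]` pays the flood part.  So located hyperplane witnesses are T3-strength and no more
  (`poly(n)·2^{O(λ^{-1/2} log(1/λ))}`): T3 is optimal in its genus up to the `log`, and a window lower bound `n^{f(λ)}` needs
  NEGATIVE MASS ON FAR ENTRIES (`inv > w`) or a non-hyperplane argument (memo §2): **PROPOSITION H″** (`farNonneg_witness_cap`, REV 3)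
  caps every witness that is merely NONNEGATIVE off the near entries by the same `4q(n+1)²/s`.  At `λ = 0`, `s = 0`: no cap (KW lives).
* §5 **The position quotient (memo rev 4, R1).**  `inv(a;π) = Σ_{l∈a} π(l) − k(k−1)/2` (`inv_eq_sum_pos`), hence
  `M_λ[a;(b,π)] = M̄_{λ,k}(π a, π b)` with `M̄_{λ,k}(A,B) = (1 − |A∩B|)² + λ·(ΣA − k(k−1)/2)` (`pencilBar`, `pencil_quotient`):
  the block `π = 1` of the slice IS `M̄` (`pencil_block_one`), every block is that block relabelled (`pencil_block_relabel`), the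
  pencil is `S_n`-invariant (`pencil_invariant`), and a nonnegative factorisation of the slice restricts to one of `M̄` through the
  same slots (`pencilBar_factorization_of_pencil`): EVERY lower bound for the permutation-free `M̄_{λ,k}` is one for the pencil.

Statements are in the factorisation style of T3/T4 (explicit slot type `S`, factors `U, V ≥ 0`, entry
identity as hypothesis), so they apply verbatim to `RealLambda.pencil n lam` once port part 2 lands
(`pencilEntry` below is the SAME FORMULA as the port's `RealLambda.pencil`; `rfl` once part 2 lands).  Imports: landed Theorems/Literature only.
VP ≠ VNP is NOT proved; `NNDivisionHard` stays OPEN; nothing here is an instance of `CoreLawHull`.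
-/

set_option linter.dupNamespace false

namespace Summit.ValiantsHypothesis.ValiantsHypothesis.Cruxes.NNDivisionHard.AsymmetricWindow39

open Finset
open Literature.Barriers.PneNP (disjPairs mem_disjPairs IsKWValid disjPairs_filter_fst_eq)
open Literature.Combinatorics.Optimization (HasNonnegFactorization hasNonnegFactorization_of_fintype)
open Summit.ValiantsHypothesis.Theorems.NNDivisionHardNegative.BlindCubeIdentity (ind ind_nonneg ind_le_one)
open Summit.ValiantsHypothesis.Theorems.NNDivisionHardNegative.WeakReliefBlind (inv invInd invInd_nonneg)

/-! ## §1  Sliced Kaibel–Weltge: the `k`-slice of unique disjointness needs `C(n,k)/2^k` slots -/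

section SlicedKW

variable {α : Type*} [DecidableEq α]

/-- The disjoint pairs `(a, b)`, `a, b ⊆ U`, with `|a| = k` number `C(|U|, k) · 2^{|U| − k}`. -/
theorem card_disjPairs_slice (U : Finset α) (k : ℕ) :
    ((disjPairs U).filter (fun p => p.1.card = k)).card = U.card.choose k * 2 ^ (U.card - k) := by
  rw [card_eq_sum_card_fiberwise (f := Prod.fst) (t := U.powersetCard k)]
  · have hfib : ∀ a ∈ U.powersetCard k,
        (((disjPairs U).filter (fun p => p.1.card = k)).filter (fun p => p.1 = a)).card = 2 ^ (U.card - k) := by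
      intro a ha
      rw [mem_powersetCard] at ha
      have h1 : ((disjPairs U).filter (fun p => p.1.card = k)).filter (fun p => p.1 = a) =
          (disjPairs U).filter (fun p => p.1 = a) := by
        ext p
        simp only [mem_filter]
        constructor
        · rintro ⟨⟨hp, _⟩, hpa⟩; exact ⟨hp, hpa⟩
        · rintro ⟨hp, hpa⟩; exact ⟨⟨hp, hpa ▸ ha.2⟩, hpa⟩
      rw [h1, disjPairs_filter_fst_eq ha.1, card_image_of_injective _ (fun b b' h => (Prod.ext_iff.1 h).2),
        card_powerset, card_sdiff_of_subset ha.1, ha.2]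
    rw [sum_congr rfl hfib, sum_const, card_powersetCard, smul_eq_mul]
  · intro p hp
    have hp' := mem_filter.1 hp
    exact mem_powersetCard.2 ⟨(mem_disjPairs.1 hp'.1).1, hp'.2⟩

/-- **Sliced Kaibel–Weltge covering bound.**  If a family `J` of rectangles `RA j × RB j`, each free of pairs
meeting in exactly one element, covers every disjoint pair `(a, b)` of subsets of `U` with `|a| = k`, then
`C(|U|,k) · 2^{|U|−k} ≤ |J| · 2^{|U|}`. -/
theorem choose_mul_two_pow_le_of_cover_slice {ι : Type*} (U : Finset α) (k : ℕ) (J : Finset ι)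
    (RA RB : ι → Set (Finset α))
    (hfree : ∀ j ∈ J, ∀ a ∈ RA j, ∀ b ∈ RB j, (a ∩ b).card ≠ 1)
    (hcover : ∀ a b : Finset α, a ⊆ U → b ⊆ U → a.card = k → Disjoint a b →
      ∃ j ∈ J, a ∈ RA j ∧ b ∈ RB j) :
    U.card.choose k * 2 ^ (U.card - k) ≤ J.card * 2 ^ U.card := by
  classical
  let R : ι → Finset (Finset α × Finset α) :=
    fun j => (disjPairs U).filter fun p => p.1 ∈ RA j ∧ p.2 ∈ RB j
  have hsub : (disjPairs U).filter (fun p => p.1.card = k) ⊆ J.biUnion R := by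
    intro p hp
    have hp' := mem_filter.1 hp
    obtain ⟨ha, hb, hd⟩ := mem_disjPairs.1 hp'.1
    obtain ⟨j, hj, hja, hjb⟩ := hcover p.1 p.2 ha hb hp'.2 hd
    exact mem_biUnion.2 ⟨j, hj, mem_filter.2 ⟨hp'.1, hja, hjb⟩⟩
  have hR : ∀ j ∈ J, (R j).card ≤ 2 ^ U.card := by
    intro j hj
    refine IsKWValid.card_le_two_pow U (R j) ?_ (filter_subset _ _)
    intro p hp q hq
    have hp' := (mem_filter.1 hp).2
    have hq' := (mem_filter.1 hq).2
    exact hfree j hj p.1 hp'.1 q.2 hq'.2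
  calc U.card.choose k * 2 ^ (U.card - k) = ((disjPairs U).filter (fun p => p.1.card = k)).card :=
        (card_disjPairs_slice U k).symm
    _ ≤ (J.biUnion R).card := card_le_card hsub
    _ ≤ ∑ j ∈ J, (R j).card := card_biUnion_le
    _ ≤ ∑ j ∈ J, 2 ^ U.card := sum_le_sum hR
    _ = J.card * 2 ^ U.card := by rw [sum_const, smul_eq_mul]

/-- The same bound divided through: `C(|U|, k) ≤ |J| · 2^k`. -/
theorem choose_le_card_mul_two_pow_of_cover_slice {ι : Type*} (U : Finset α) (k : ℕ) (J : Finset ι)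
    (RA RB : ι → Set (Finset α))
    (hfree : ∀ j ∈ J, ∀ a ∈ RA j, ∀ b ∈ RB j, (a ∩ b).card ≠ 1)
    (hcover : ∀ a b : Finset α, a ⊆ U → b ⊆ U → a.card = k → Disjoint a b →
      ∃ j ∈ J, a ∈ RA j ∧ b ∈ RB j) :
    U.card.choose k ≤ J.card * 2 ^ k := by
  by_cases hk : k ≤ U.card
  · have h := choose_mul_two_pow_le_of_cover_slice U k J RA RB hfree hcover
    have hpow : 2 ^ U.card = 2 ^ k * 2 ^ (U.card - k) := by rw [← pow_add, Nat.add_sub_cancel' hk]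
    rw [hpow, ← mul_assoc] at h
    exact Nat.le_of_mul_le_mul_right h (Nat.pos_of_ne_zero (pow_ne_zero _ two_ne_zero))
  · rw [Nat.choose_eq_zero_of_lt (Nat.lt_of_not_le hk)]; exact Nat.zero_le _

/-- **Sliced Kaibel–Weltge, factorisation form (the λ = 0 endpoint on the slice `k`).**  A nonnegative
factorisation `Σ_s U_r(s) V_c(s)` through a finite slot type `ι` which reproduces `(1 − |a∩b|)²` on the rows
`|a| = k` (row `row a`) against all columns `col b` has `C(|α|, k) ≤ |ι| · 2^k` — the support rectangles of the
slots are free of `|a∩b| = 1` and cover the disjoint pairs. -/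
theorem choose_le_card_mul_two_pow_of_slice_block {R C ι : Type*} [Fintype ι] [Fintype α] (k : ℕ)
    (U : R → ι → ℝ) (V : C → ι → ℝ) (hU : ∀ r i, 0 ≤ U r i) (hV : ∀ c i, 0 ≤ V c i)
    (row : Finset α → R) (col : Finset α → C)
    (hblock : ∀ a b : Finset α, a.card = k → ∑ i, U (row a) i * V (col b) i = (1 - ((a ∩ b).card : ℝ)) ^ 2) :
    (Fintype.card α).choose k ≤ Fintype.card ι * 2 ^ k := by
  classical
  have h := choose_le_card_mul_two_pow_of_cover_slice (Finset.univ : Finset α) k (Finset.univ : Finset ι)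
    (fun i => {a | a.card = k ∧ 0 < U (row a) i}) (fun i => {b | 0 < V (col b) i}) ?_ ?_
  · simpa using h
  · intro i _ a ha b hb h1
    simp only [Set.mem_setOf_eq] at ha hb
    have hsum := hblock a b ha.1
    rw [h1] at hsum
    norm_num at hsum
    have hpos : 0 < ∑ i, U (row a) i * V (col b) i :=
      lt_of_lt_of_le (mul_pos ha.2 hb) (single_le_sum (fun j _ => mul_nonneg (hU _ j) (hV _ j)) (mem_univ i))
    linarith
  · intro a b _ _ hak hab
    have hsum := hblock a b hak
    rw [disjoint_iff_inter_eq_empty.1 hab] at hsum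
    norm_num at hsum
    have hex : ∃ i, 0 < U (row a) i * V (col b) i := by
      by_contra hne
      simp only [not_exists, not_lt] at hne
      have : ∑ i, U (row a) i * V (col b) i ≤ 0 := sum_nonpos fun i _ => hne i
      linarith
    obtain ⟨i, hi⟩ := hex
    have hUi : 0 < U (row a) i := by
      rcases (hU (row a) i).lt_or_eq with h | h
      · exact h
      · rw [← h, zero_mul] at hi; exact absurd hi (lt_irrefl 0)
    exact ⟨i, mem_univ i, ⟨hak, hUi⟩, pos_of_mul_pos_right hi (hU _ i)⟩

end SlicedKW

/-! ## §2  The located pencil: entry, λ = 0 endpoint on the slices, monotonicity in λ -/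

section Pencil

variable {n : ℕ}

/-- The entry of the located permutahedron pencil `M_λ[a; (b,π)] = (1 − |a∩b|)² + λ·inv(a;π)` (real-valued;
the same formula as `RealLambda.pencil n lam a (b, π)` of port part 2 — not imported here, Cruxes files import landed modules only). -/
def pencilEntry (n : ℕ) (lam : ℝ) (a : Finset (Fin n)) (bπ : Finset (Fin n) × Equiv.Perm (Fin n)) : ℝ :=
  ((1 : ℝ) - ((a ∩ bπ.1).card : ℝ)) ^ 2 + lam * (inv a bπ.2 : ℝ)

/-- **λ = 0 endpoint on the slice `k`:** a nonnegative factorisation of `M_0` through a finite slot type `S`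
which is exact on the rows `|a| = k` has `C(n,k) ≤ |S| · 2^k`.  (At `λ = 0` the column parameter `π` is idle;
the slice of unique disjointness has rank `≤ 1 + n + C(n,2)` but nonnegative rank `≥ C(n,k)/2^k`.) -/
theorem pencil_zero_slice_lower (k : ℕ) {S : Type*} [Fintype S]
    (U : Finset (Fin n) → S → ℝ) (V : Finset (Fin n) × Equiv.Perm (Fin n) → S → ℝ)
    (hU : ∀ a s, 0 ≤ U a s) (hV : ∀ bπ s, 0 ≤ V bπ s)
    (hfac : ∀ a bπ, a.card = k → pencilEntry n 0 a bπ = ∑ s, U a s * V bπ s) :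
    n.choose k ≤ Fintype.card S * 2 ^ k := by
  have h := choose_le_card_mul_two_pow_of_slice_block (α := Fin n) k U V hU hV id (fun b => (b, 1)) ?_
  · simpa using h
  · intro a b hak
    have := hfac a (b, 1) hak
    simp only [pencilEntry, zero_mul, add_zero] at this
    exact this.symm

/-- `inv(a;π)` is an explicit cone term: `inv a π = Σ_{(l,l′)} ([l ∈ a][l′ ∉ a]) · [π(l′) < π(l)]` with nonnegative
row factor `[l ∈ a][l′ ∉ a]` and nonnegative column factor `[π(l′) < π(l)]` — `n²` slots. -/
theorem inv_cast_sum (a : Finset (Fin n)) (π : Equiv.Perm (Fin n)) :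
    (inv a π : ℝ) = ∑ p : Fin n × Fin n, ((ind a p.1 : ℝ) * (1 - (ind a p.2 : ℝ))) * (invInd π p.1 p.2 : ℝ) := by
  unfold inv
  push_cast
  rw [← Finset.sum_product' (f := fun l l' => (ind a l : ℝ) * (1 - (ind a l' : ℝ)) * (invInd π l l' : ℝ))]
  rfl

/-- **Monotonicity in λ (factorisation form).**  From a nonnegative factorisation of `M_{λ′}` through `S` one gets
one of `M_λ`, `λ′ ≤ λ`, through `S ⊕ (Fin n × Fin n)`: add the `n²` cone slots of `(λ − λ′)·inv`. -/
theorem pencilEntry_factorization_mono {lam' lam : ℝ} (hle : lam' ≤ lam) {r : ℕ}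
    (h : HasNonnegFactorization (pencilEntry n lam') r) :
    HasNonnegFactorization (pencilEntry n lam) (r + Fintype.card (Fin n × Fin n)) := by
  have hinv : HasNonnegFactorization
      (fun (a : Finset (Fin n)) (bπ : Finset (Fin n) × Equiv.Perm (Fin n)) => (lam - lam') * (inv a bπ.2 : ℝ))
      (Fintype.card (Fin n × Fin n)) := by
    refine hasNonnegFactorization_of_fintype
      (fun a p => (lam - lam') * ((ind a p.1 : ℝ) * (1 - (ind a p.2 : ℝ))))
      (fun p bπ => (invInd bπ.2 p.1 p.2 : ℝ)) ?_ ?_ ?_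
    · intro a p
      have h0 : (0 : ℝ) ≤ (ind a p.1 : ℝ) := by exact_mod_cast ind_nonneg a p.1
      have h1 : (ind a p.2 : ℝ) ≤ 1 := by exact_mod_cast ind_le_one a p.2
      exact mul_nonneg (by linarith) (mul_nonneg h0 (by linarith))
    · intro p bπ
      exact_mod_cast invInd_nonneg bπ.2 p.1 p.2
    · intro a bπ
      rw [inv_cast_sum, Finset.mul_sum]
      refine Finset.sum_congr rfl fun p _ => ?_
      ring
  have hsum := h.add hinv
  refine (show pencilEntry n lam = fun a bπ => pencilEntry n lam' a bπ + (lam - lam') * (inv a bπ.2 : ℝ) from ?_) ▸ hsum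
  funext a bπ
  simp only [pencilEntry]
  ring

/-- The slot count in `pencilEntry_factorization_mono`, spelled out: `|Fin n × Fin n| = n²`. -/
theorem card_slots_sq : Fintype.card (Fin n × Fin n) = n ^ 2 := by
  simp [sq]

/-- **Monotonicity in λ, `n²` form:** `rank₊ M_λ ≤ rank₊ M_{λ′} + n²` for `λ′ ≤ λ`; equivalently every LOWER bound
`rank₊ M_λ > r + n²` transfers to `rank₊ M_{λ′} > r` for all `λ′ ≤ λ` (visibility is downward closed in `λ`
up to `n²`), and every certificate at `λ′` is one at all `λ ≥ λ′` with `n²` more slots. -/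
theorem pencilEntry_factorization_mono' {lam' lam : ℝ} (hle : lam' ≤ lam) {r : ℕ}
    (h : HasNonnegFactorization (pencilEntry n lam') r) :
    HasNonnegFactorization (pencilEntry n lam) (r + n ^ 2) := by
  have := pencilEntry_factorization_mono hle h
  rwa [card_slots_sq] at this

/-- Contrapositive bookkeeping: a lower bound at `λ` is a lower bound at every `λ′ ≤ λ`, shifted by `n²`. -/
theorem pencilEntry_lower_downward {lam' lam : ℝ} (hle : lam' ≤ lam) {r : ℕ}
    (hlow : ¬ HasNonnegFactorization (pencilEntry n lam) (r + n ^ 2)) :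
    ¬ HasNonnegFactorization (pencilEntry n lam') r :=
  fun h => hlow (pencilEntry_factorization_mono' hle h)

end Pencil

/-! ## §3  The located neighbourhood: per column and slice only `(w+1)^{2√w}` rows have flood `inv ≤ w`

This is the counting fact behind the exponent `λ^{-1/2}` of T3 and behind ceiling (i) of the memo: an entry
`M_λ[a;(b,π)]` is informative (`λ·inv(a;π) ≤ W`) only if `a` differs from the located base `P_k(π)` by
`j ≤ √(W/λ)` swaps inside the two position windows of width `W/λ` around the cut `k`; so every method whose
witness lives on the informative entries of one column (corruption / discrepancy / common information per
cluster) sees at most `(W/λ + 1)^{2√(W/λ)} = 2^{Õ(λ^{-1/2})}` rows. -/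

section Informative

variable {n : ℕ}

open Summit.ValiantsHypothesis.Theorems.NNDivisionHardNegative.WeakReliefBlind (posLT card_posLT)

/-- membership in the located initial segment `P_m(π) = {l : π(l) < m}` -/
theorem mem_posLT_iff (π : Equiv.Perm (Fin n)) (m : ℕ) (l : Fin n) : l ∈ posLT π m ↔ (π l : ℕ) < m := by
  simp [posLT]

/-- `|P_m(π)| ≤ m` for every `m` (with equality for `m ≤ n`, `card_posLT`). -/
theorem card_posLT_le (π : Equiv.Perm (Fin n)) (m : ℕ) : (posLT π m).card ≤ m := by
  by_cases hm : m ≤ n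
  · exact (card_posLT π hm).le
  · calc (posLT π m).card ≤ (Finset.univ : Finset (Fin n)).card := card_le_card (Finset.subset_univ _)
      _ ≤ m := by rw [Finset.card_univ, Fintype.card_fin]; exact (Nat.lt_of_not_le hm).le

/-- `P_m(π) ⊆ P_{m'}(π)` for `m ≤ m'`. -/
theorem posLT_mono (π : Equiv.Perm (Fin n)) {m m' : ℕ} (h : m ≤ m') : posLT π m ⊆ posLT π m' := by
  intro l hl
  rw [mem_posLT_iff] at hl ⊢
  exact lt_of_lt_of_le hl h

/-- the inversion pairs of the row `a` against `π`: `(l, l′)` with `l ∈ a`, `l′ ∉ a`, `π(l′) < π(l)` -/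
def invPairs (a : Finset (Fin n)) (π : Equiv.Perm (Fin n)) : Finset (Fin n × Fin n) :=
  Finset.univ.filter fun p => p.1 ∈ a ∧ p.2 ∉ a ∧ π p.2 < π p.1

theorem mem_invPairs {a : Finset (Fin n)} {π : Equiv.Perm (Fin n)} {p : Fin n × Fin n} :
    p ∈ invPairs a π ↔ p.1 ∈ a ∧ p.2 ∉ a ∧ π p.2 < π p.1 := by
  simp [invPairs]

/-- `inv(a;π)` is the number of inversion pairs. -/
theorem inv_eq_card_invPairs (a : Finset (Fin n)) (π : Equiv.Perm (Fin n)) :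
    inv a π = ((invPairs a π).card : ℤ) := by
  unfold inv invPairs
  rw [Finset.card_filter]
  push_cast
  rw [← Finset.sum_product' (f := fun l l' => ind a l * (1 - ind a l') * invInd π l l')]
  refine Finset.sum_congr rfl fun p _ => ?_
  unfold ind invInd
  by_cases h1 : p.1 ∈ a <;> by_cases h2 : p.2 ∈ a <;> by_cases h3 : π p.2 < π p.1 <;> simp [h1, h2, h3]

/-- **Boundary pairs are inversions:** every pair `(o ∈ a ∖ P_k(π), i ∈ P_k(π) ∖ a)` is an inversion, so
`|a ∖ P_k(π)| · |P_k(π) ∖ a| ≤ inv(a;π)`. -/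
theorem card_sdiff_mul_le_inv (a : Finset (Fin n)) (π : Equiv.Perm (Fin n)) (k : ℕ) :
    (((a \ posLT π k).card * (posLT π k \ a).card : ℕ) : ℤ) ≤ inv a π := by
  rw [inv_eq_card_invPairs, ← Finset.card_product]
  have hsub : (a \ posLT π k) ×ˢ (posLT π k \ a) ⊆ invPairs a π := by
    intro p hp
    rw [Finset.mem_product, Finset.mem_sdiff, Finset.mem_sdiff, mem_posLT_iff, mem_posLT_iff] at hp
    obtain ⟨⟨ho, hok⟩, hik, hia⟩ := hp
    refine mem_invPairs.2 ⟨ho, hia, ?_⟩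
    rw [Fin.lt_def]
    omega
  exact_mod_cast card_le_card hsub

/-- **Upper window:** an element `o ∈ a` beyond the cut (`π(o) ≥ k`, `|a| = k`) alone forces
`π(o) + 1 − k ≤ inv(a;π)` (the `π(o)` smaller positions hold at most `k − 1` elements of `a`). -/
theorem pos_add_one_sub_le_inv {a : Finset (Fin n)} {k : ℕ} (hak : a.card = k) (π : Equiv.Perm (Fin n))
    {o : Fin n} (ho : o ∈ a \ posLT π k) : ((π o : ℕ) : ℤ) + 1 - k ≤ inv a π := by
  rw [inv_eq_card_invPairs]
  have hoa : o ∈ a := (Finset.mem_sdiff.1 ho).1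
  have hsub : ({o} : Finset (Fin n)) ×ˢ (posLT π (π o) \ a) ⊆ invPairs a π := by
    intro p hp
    rw [Finset.mem_product, Finset.mem_singleton, Finset.mem_sdiff, mem_posLT_iff] at hp
    obtain ⟨hp1, hl', hl'a⟩ := hp
    refine mem_invPairs.2 ⟨hp1 ▸ hoa, hl'a, ?_⟩
    rw [Fin.lt_def, hp1]
    exact hl'
  have h1 := Finset.card_sdiff_add_card_inter (posLT π (π o)) a
  have hX : (posLT π (π o)).card = (π o : ℕ) := card_posLT π (π o).is_lt.le
  have h2 : (posLT π (π o) ∩ a).card ≤ k - 1 := by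
    have hsub' : posLT π (π o) ∩ a ⊆ a.erase o := by
      intro l hl
      rw [Finset.mem_inter, mem_posLT_iff] at hl
      rw [Finset.mem_erase]
      refine ⟨?_, hl.2⟩
      rintro rfl
      exact lt_irrefl _ hl.1
    calc (posLT π (π o) ∩ a).card ≤ (a.erase o).card := card_le_card hsub'
      _ = k - 1 := by rw [Finset.card_erase_of_mem hoa, hak]
  have hk1 : 1 ≤ k := by rw [← hak]; exact Finset.card_pos.2 ⟨o, hoa⟩
  have h3 := card_le_card hsub
  rw [Finset.card_product, Finset.card_singleton, one_mul] at h3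
  have h4 : (π o : ℕ) + 1 - k ≤ (invPairs a π).card := by omega
  omega

/-- **Lower window:** an element `i ∉ a` before the cut (`π(i) < k`, `|a| = k`) alone forces
`k − π(i) ≤ inv(a;π)` (the positions above `π(i)` miss at most `π(i)` elements of `a`). -/
theorem sub_pos_le_inv {a : Finset (Fin n)} {k : ℕ} (hak : a.card = k) (π : Equiv.Perm (Fin n))
    {i : Fin n} (hi : i ∈ posLT π k \ a) : (k : ℤ) - (π i : ℕ) ≤ inv a π := by
  rw [inv_eq_card_invPairs]
  have hia : i ∉ a := (Finset.mem_sdiff.1 hi).2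
  have hsub : (a \ posLT π ((π i : ℕ) + 1)) ×ˢ ({i} : Finset (Fin n)) ⊆ invPairs a π := by
    intro p hp
    rw [Finset.mem_product, Finset.mem_singleton, Finset.mem_sdiff, mem_posLT_iff] at hp
    obtain ⟨⟨hl, hlX⟩, hp2⟩ := hp
    refine mem_invPairs.2 ⟨hl, hp2 ▸ hia, ?_⟩
    rw [Fin.lt_def, hp2]
    omega
  have h1 := Finset.card_sdiff_add_card_inter a (posLT π ((π i : ℕ) + 1))
  have hX : (posLT π ((π i : ℕ) + 1)).card = (π i : ℕ) + 1 := card_posLT π (π i).is_lt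
  have h2 : (a ∩ posLT π ((π i : ℕ) + 1)).card ≤ (π i : ℕ) := by
    have hsub' : a ∩ posLT π ((π i : ℕ) + 1) ⊆ (posLT π ((π i : ℕ) + 1)).erase i := by
      intro l hl
      rw [Finset.mem_inter] at hl
      rw [Finset.mem_erase]
      refine ⟨?_, hl.2⟩
      rintro rfl
      exact hia hl.1
    calc (a ∩ posLT π ((π i : ℕ) + 1)).card ≤ ((posLT π ((π i : ℕ) + 1)).erase i).card := card_le_card hsub'
      _ = (π i : ℕ) := by
          rw [Finset.card_erase_of_mem ((mem_posLT_iff _ _ _).2 (Nat.lt_succ_self _)), hX]; rfl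
  have h3 := card_le_card hsub
  rw [Finset.card_product, Finset.card_singleton, mul_one] at h3
  have h4 : k - (π i : ℕ) ≤ (invPairs a π).card := by omega
  omega

/-- **Structure of the informative rows.**  If `|a| = k ≤ n` and `inv(a;π) ≤ w` then `a` is the base `P_k(π)`
with `j` elements of the upper window `{k ≤ π < k + w}` swapped in for `j` elements of the lower window
`{k − w ≤ π < k}`, and `j² ≤ w`. -/
theorem informative_row_structure (π : Equiv.Perm (Fin n)) {k : ℕ} (hkn : k ≤ n) (w : ℕ)
    {a : Finset (Fin n)} (hak : a.card = k) (hw : inv a π ≤ w) :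
    a \ posLT π k ⊆ posLT π (k + w) \ posLT π k ∧
    posLT π k \ a ⊆ posLT π k \ posLT π (k - w) ∧
    (posLT π k \ a).card = (a \ posLT π k).card ∧
    (a \ posLT π k).card * (a \ posLT π k).card ≤ w := by
  have hPk : (posLT π k).card = k := card_posLT π hkn
  have hcard : (posLT π k \ a).card = (a \ posLT π k).card := by
    have h1 := Finset.card_sdiff_add_card_inter (posLT π k) a
    have h2 := Finset.card_sdiff_add_card_inter a (posLT π k)
    rw [Finset.inter_comm] at h2
    omega
  refine ⟨?_, ?_, hcard, ?_⟩
  · intro o ho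
    have h := pos_add_one_sub_le_inv hak π ho
    rw [Finset.mem_sdiff] at ho ⊢
    refine ⟨(mem_posLT_iff _ _ _).2 ?_, ho.2⟩
    have : ((π o : ℕ) : ℤ) + 1 - k ≤ w := le_trans h hw
    omega
  · intro i hi
    have h := sub_pos_le_inv hak π hi
    rw [Finset.mem_sdiff] at hi ⊢
    refine ⟨hi.1, fun hlt => ?_⟩
    rw [mem_posLT_iff] at hlt
    have : (k : ℤ) - (π i : ℕ) ≤ w := le_trans h hw
    omega
  · have h := le_trans (card_sdiff_mul_le_inv a π k) hw
    rw [hcard] at h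
    exact_mod_cast h

/-- A partial row sum of Pascal's triangle: `Σ_{s ≤ W} C(m, s) ≤ (m+1)^W`.
[folklore; cf. `Literature.Computability.MetaComplexity.ParityDNF.sum_range_succ_choose_le_pow`] -/
theorem sum_range_succ_choose_le_pow (m W : ℕ) : ∑ s ∈ range (W + 1), m.choose s ≤ (m + 1) ^ W := by
  induction W with
  | zero => simp
  | succ W ih =>
    rw [sum_range_succ, pow_succ]
    have h1 := Nat.choose_le_pow m (W + 1)
    have h2 : m ^ (W + 1) ≤ m * (m + 1) ^ W := by
      rw [pow_succ, mul_comm]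
      exact Nat.mul_le_mul_left m (Nat.pow_le_pow_left (Nat.le_succ m) W)
    nlinarith

/-- The subsets of `X` of size at most `J` number at most `(|X|+1)^J`. [folklore] -/
theorem card_powerset_filter_card_le_pow {β : Type*} [DecidableEq β] (X : Finset β) (J : ℕ) :
    (X.powerset.filter fun S => S.card ≤ J).card ≤ (X.card + 1) ^ J := by
  have hsub : (X.powerset.filter fun S => S.card ≤ J) ⊆ (range (J + 1)).biUnion fun s => powersetCard s X := by
    intro S hS
    rw [mem_filter, mem_powerset] at hS
    rw [mem_biUnion]
    exact ⟨S.card, mem_range.2 (Nat.lt_succ_of_le hS.2), mem_powersetCard.2 ⟨hS.1, rfl⟩⟩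
  refine (card_le_card hsub).trans ((card_biUnion_le).trans ?_)
  simp only [card_powersetCard]
  exact sum_range_succ_choose_le_pow X.card J

/-- **The located neighbourhood is small:** per column `π` and slice `k ≤ n`, at most `((w+1)^{√w})²` rows
`a` have `inv(a;π) ≤ w` — independently of `n`.  (With `w = W/λ`: `2^{O(λ^{-1/2}·log(W/λ))}` informative
rows per column; ceiling (i) of the memo.) -/
theorem card_informative_rows_le (π : Equiv.Perm (Fin n)) {k : ℕ} (hkn : k ≤ n) (w : ℕ) :
    ((Finset.univ : Finset (Finset (Fin n))).filter (fun a => a.card = k ∧ inv a π ≤ w)).card ≤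
      ((w + 1) ^ Nat.sqrt w) ^ 2 := by
  classical
  set A := posLT π (k + w) \ posLT π k with hA
  set B := posLT π k \ posLT π (k - w) with hB
  set FA := A.powerset.filter fun S => S.card ≤ Nat.sqrt w with hFA
  set FB := B.powerset.filter fun S => S.card ≤ Nat.sqrt w with hFB
  have hAc : A.card ≤ w := by
    rw [hA, card_sdiff_of_subset (posLT_mono π (Nat.le_add_right k w)), card_posLT π hkn]
    have := card_posLT_le π (k + w)
    omega
  have hBc : B.card ≤ w := by
    rw [hB, card_sdiff_of_subset (posLT_mono π (Nat.sub_le k w)), card_posLT π hkn,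
      card_posLT π ((Nat.sub_le k w).trans hkn)]
    omega
  have hinj : ((Finset.univ : Finset (Finset (Fin n))).filter (fun a => a.card = k ∧ inv a π ≤ w)).card ≤
      (FA ×ˢ FB).card := by
    refine Finset.card_le_card_of_injOn (fun a => (a \ posLT π k, posLT π k \ a)) ?_ ?_
    · intro a ha
      rw [Finset.mem_coe, mem_filter] at ha
      obtain ⟨h1, h2, h3, h4⟩ := informative_row_structure π hkn w ha.2.1 ha.2.2
      rw [Finset.mem_coe, Finset.mem_product, hFA, hFB, mem_filter, mem_filter, mem_powerset, mem_powerset]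
      refine ⟨⟨h1, Nat.le_sqrt.2 h4⟩, ⟨h2, ?_⟩⟩
      rw [h3]; exact Nat.le_sqrt.2 h4
    · intro a _ a' _ h
      simp only [Prod.mk.injEq] at h
      obtain ⟨ho, hi⟩ := h
      have key : ∀ s : Finset (Fin n), s = (posLT π k \ (posLT π k \ s)) ∪ (s \ posLT π k) := by
        intro s; ext l
        simp only [Finset.mem_union, Finset.mem_sdiff]
        tauto
      rw [key a, key a', ho, hi]
  refine hinj.trans ?_
  rw [Finset.card_product, sq]
  refine Nat.mul_le_mul ?_ ?_
  · exact (card_powerset_filter_card_le_pow A _).trans (Nat.pow_le_pow_left (by omega) _)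
  · exact (card_powerset_filter_card_le_pow B _).trans (Nat.pow_le_pow_left (by omega) _)

end Informative

/-! ## §4  PROPOSITION H in kernel: hash rectangles cap every located disjointness-pattern witness (no `n`-dependence)

The hyperplane (rectangle-LP) bound of a weight `W` is `B_W = ⟨W,M⟩ / max{⟨W, u vᵀ⟩ : u, v ≥ 0, u vᵀ ≤ M}`; every nonnegative
factorisation has `≥ B_W` slots.  A CAP on a CLASS of witnesses is a feasible rectangle that every `W` of the class rewards.
CLASS D (located disjointness-pattern witnesses, the genus of Kaibel–Weltge / Razborov / BFPS Thm 5, hence of T2 and T3, however glued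
across clusters): `W` vanishes off the NEAR entries (`near a c`), is `≥ 0` on near entries of intersection LEVEL `≠ 1` and (for the ratio)
`≤ 0` on near entries of level `1`.  THE CAP (`hash_rectangle_cap`, abstract; `located_disjointness_witness_cap`, the pencil): for a hash family
`H : Ξ → Row → Prop` with `Pr[H a] ≥ 1/q` and `Pr[H a ∧ H a′] ≤ 1/q²` (`a ≠ a′`) and `q ≥ 2N₁`, `N₁` = max number of near level-1 rows of a
column, SOME hash rectangle `u = s·1_{H ξ}`, `v = 1_{no near level-1 row of c is hit}` is feasible (`u vᵀ ≤ M`) and earns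
`⟨W, u vᵀ⟩ ≥ (s/2q)·Σ⁺`, `Σ⁺ = Σ_{near, level ≠ 1} W`, while `⟨W, M⟩ ≤ M⁺·Σ⁺`; so `B_W ≤ 2q·M⁺/s` — for the pencil on the slice `k` with
budget `w ≥ 1/λ − 1`: `s = 1`, `q = 2((w+1)^{√w})²` (K3), `M⁺ ≤ (√w−1)² + λw` on the canonical clusters `b ∩ P_k(π) = ∅` (`≤ (k−1)² + λw ≤ n²`
for arbitrary columns): `B_W = 2^{O(√w log w)}` (times at most `n²`), no `n^{f(λ)}`.
The capping rectangles are the hash classes `{a : Σ_{x∈a} ω(x) = c₀ in ℤ_q}` — an ASYMMETRIC row family (neither juntas nor symmetric).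
PROPOSITION H′ (`hash_carrier_cap` = hash × arbitrary feasible carrier with an exclusion relation; `located_witness_cap` = the pencil):
the sign condition is unnecessary — every `W` vanishing off the near entries of the slice is capped, `s·⟨W,M_λ⟩ ≤ 4q(n+1)²·⟨W,u vᵀ⟩`,
by the better of the hashed unit carrier (columns with a hit level-1 or negative near row excluded) and a hashed inversion carrier
`λ[l∈a][l′∉a] ⊗ [π(l′)<π(l)] ≤ λ·inv ≤ M_λ` (columns with a hit negative near row excluded; `n²` carriers, pigeonhole). -/

section HashCap

/-- **Abstract hash-rectangle cap.**  Rows, columns, a hash index type `Ξ`; `near`/`lvl` = the located structure; `M ≥ 0` with `M ≥ s` on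
every entry that is not a near level-1 entry; a hash family hitting each row with probability `≥ 1/q` and each pair of distinct rows with
probability `≤ 1/q²`; at most `N₁ ≤ q/2` near level-1 rows per column; `W = 0` off the near entries and `W ≥ 0` on near entries of level `≠ 1`.
Then some hash rectangle `u vᵀ ≤ M` has `s·Σ⁺ ≤ 2q·⟨W, u vᵀ⟩`. -/
theorem hash_rectangle_cap {Row Col Ξ : Type*} [Fintype Row] [DecidableEq Row] [Fintype Col] [Fintype Ξ] [Nonempty Ξ]
    (M W : Row → Col → ℝ) (near : Row → Col → Prop) [∀ a c, Decidable (near a c)] (lvl : Row → Col → ℕ)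
    (H : Ξ → Row → Prop) [∀ ξ a, Decidable (H ξ a)] {q N₁ : ℕ} (hq : 0 < q) (hqN : 2 * N₁ ≤ q)
    {s : ℝ} (hs : 0 ≤ s) (hM0 : ∀ a c, 0 ≤ M a c)
    (hM : ∀ a c, (near a c → lvl a c ≠ 1) → s ≤ M a c)
    (hH1 : ∀ a, (Fintype.card Ξ : ℝ) ≤ q * ((Finset.univ.filter (fun ξ => H ξ a)).card : ℝ))
    (hH2 : ∀ a a', a ≠ a' →
      (q : ℝ) ^ 2 * ((Finset.univ.filter (fun ξ => H ξ a ∧ H ξ a')).card : ℝ) ≤ Fintype.card Ξ)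
    (hN : ∀ c, (Finset.univ.filter (fun a => near a c ∧ lvl a c = 1)).card ≤ N₁)
    (hWfar : ∀ a c, ¬ near a c → W a c = 0)
    (hWpos : ∀ a c, near a c → lvl a c ≠ 1 → 0 ≤ W a c) :
    ∃ (u : Row → ℝ) (v : Col → ℝ), (∀ a, 0 ≤ u a) ∧ (∀ c, 0 ≤ v c) ∧ (∀ a c, u a * v c ≤ M a c) ∧
      s * (∑ a, ∑ c, if near a c ∧ lvl a c ≠ 1 then W a c else 0) ≤
        2 * q * ∑ a, ∑ c, W a c * (u a * v c) := by
  classical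
  -- the hash rectangle of `ξ`
  let B : Ξ → Col → Prop := fun ξ c => ∀ a', near a' c → lvl a' c = 1 → ¬ H ξ a'
  let u : Ξ → Row → ℝ := fun ξ a => if H ξ a then s else 0
  let v : Ξ → Col → ℝ := fun ξ c => if B ξ c then 1 else 0
  have hu0 : ∀ ξ a, 0 ≤ u ξ a := fun ξ a => by simp only [u]; split_ifs <;> simp [hs]
  have hv0 : ∀ ξ c, 0 ≤ v ξ c := fun ξ c => by simp only [v]; split_ifs <;> simp
  have huv : ∀ ξ a c, u ξ a * v ξ c = if H ξ a ∧ B ξ c then s else 0 := by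
    intro ξ a c; simp only [u, v]; split_ifs <;> simp_all
  -- feasibility
  have hfeas : ∀ ξ a c, u ξ a * v ξ c ≤ M a c := by
    intro ξ a c
    rw [huv]
    split_ifs with h
    · refine hM a c fun hn h1 => ?_
      exact h.2 a hn h1 h.1
    · exact hM0 a c
  -- the count K(a,c) = #{ξ : H ξ a ∧ B ξ c} for a near entry of level ≠ 1
  have hK : ∀ a c, near a c → lvl a c ≠ 1 →
      (Fintype.card Ξ : ℝ) ≤ 2 * q * ((Finset.univ.filter (fun ξ => H ξ a ∧ B ξ c)).card : ℝ) := by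
    intro a c hn hl
    set N1c := Finset.univ.filter (fun a' => near a' c ∧ lvl a' c = 1) with hN1c
    have hcover : Finset.univ.filter (fun ξ => H ξ a) ⊆
        Finset.univ.filter (fun ξ => H ξ a ∧ B ξ c) ∪
          N1c.biUnion (fun a' => Finset.univ.filter (fun ξ => H ξ a ∧ H ξ a')) := by
      intro ξ hξ
      rw [mem_filter] at hξ
      rw [Finset.mem_union, mem_filter, Finset.mem_biUnion]
      by_cases hB : B ξ c
      · exact Or.inl ⟨mem_univ _, hξ.2, hB⟩
      · right
        simp only [B, not_forall, not_not, exists_prop] at hB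
        obtain ⟨a', ha'n, ha'l, ha'H⟩ := hB
        exact ⟨a', mem_filter.2 ⟨mem_univ _, ha'n, ha'l⟩, mem_filter.2 ⟨mem_univ _, hξ.2, ha'H⟩⟩
    have h1 : ((Finset.univ.filter (fun ξ => H ξ a)).card : ℝ) ≤
        ((Finset.univ.filter (fun ξ => H ξ a ∧ B ξ c)).card : ℝ) +
          ∑ a' ∈ N1c, ((Finset.univ.filter (fun ξ => H ξ a ∧ H ξ a')).card : ℝ) := by
      have := (card_le_card hcover).trans
        ((Finset.card_union_le _ _).trans (Nat.add_le_add_left Finset.card_biUnion_le _))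
      exact_mod_cast this
    have h2 : ∀ a' ∈ N1c, (q : ℝ) ^ 2 * ((Finset.univ.filter (fun ξ => H ξ a ∧ H ξ a')).card : ℝ) ≤
        Fintype.card Ξ := by
      intro a' ha'
      refine hH2 a a' fun h => hl ?_
      rw [h]; exact ((mem_filter.1 ha').2).2
    have h3 : (q : ℝ) ^ 2 * ∑ a' ∈ N1c, ((Finset.univ.filter (fun ξ => H ξ a ∧ H ξ a')).card : ℝ) ≤
        N1c.card * Fintype.card Ξ := by
      rw [Finset.mul_sum]
      have := Finset.sum_le_sum h2
      simpa using this
    have hqr : (0 : ℝ) < q := by exact_mod_cast hq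
    have hNc : (N1c.card : ℝ) * 2 ≤ q := by
      have := (hN c); rw [← hN1c] at this
      have : (N1c.card : ℝ) ≤ N₁ := by exact_mod_cast this
      have hqN' : (2 * N₁ : ℝ) ≤ q := by exact_mod_cast hqN
      linarith
    have hX := hH1 a
    -- combine: card Ξ ≤ q·#H = q·(K + S) and q²·S ≤ |N1c|·card Ξ ≤ (q/2)·card Ξ
    have hcardnn : (0 : ℝ) ≤ Fintype.card Ξ := Nat.cast_nonneg _
    nlinarith [h1, h3, hNc, hX, hqr, hcardnn,
      mul_nonneg hqr.le (Nat.cast_nonneg (Finset.univ.filter (fun ξ => H ξ a ∧ B ξ c)).card)]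
  -- the averaged reward, entry by entry
  have hentry : ∀ a c, (Fintype.card Ξ : ℝ) * (s * (if near a c ∧ lvl a c ≠ 1 then W a c else 0)) ≤
      2 * q * ∑ ξ, W a c * (u ξ a * v ξ c) := by
    intro a c
    have hcount : ∑ ξ, W a c * (u ξ a * v ξ c) =
        W a c * s * ((Finset.univ.filter (fun ξ => H ξ a ∧ B ξ c)).card : ℝ) := by
      simp only [huv]
      rw [← Finset.mul_sum, Finset.sum_ite, Finset.sum_const_zero, add_zero, Finset.sum_const, nsmul_eq_mul]
      ring
    rw [hcount]
    by_cases hn : near a c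
    · by_cases hl : lvl a c ≠ 1
      · rw [if_pos ⟨hn, hl⟩]
        have hKac := hK a c hn hl
        have hW := hWpos a c hn hl
        nlinarith [mul_nonneg hW hs]
      · -- level 1: the rectangle vanishes there
        rw [if_neg (fun h => hl h.2)]
        have hempty : Finset.univ.filter (fun ξ => H ξ a ∧ B ξ c) = ∅ := by
          rw [Finset.filter_eq_empty_iff]
          intro ξ _ h
          exact h.2 a hn (not_not.1 hl) h.1
        rw [hempty]; simp
    · rw [if_neg (fun h => hn h.1), hWfar a c hn]; simp
  have hG : (Fintype.card Ξ : ℝ) * (s * ∑ a, ∑ c, if near a c ∧ lvl a c ≠ 1 then W a c else 0) ≤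
      2 * q * ∑ ξ, ∑ a, ∑ c, W a c * (u ξ a * v ξ c) := by
    have hcomm : ∑ ξ, ∑ a, ∑ c, W a c * (u ξ a * v ξ c) = ∑ a, ∑ c, ∑ ξ, W a c * (u ξ a * v ξ c) := by
      rw [Finset.sum_comm]
      exact Finset.sum_congr rfl fun a _ => Finset.sum_comm
    rw [hcomm, Finset.mul_sum, Finset.mul_sum, Finset.mul_sum]
    refine Finset.sum_le_sum fun a _ => ?_
    rw [Finset.mul_sum, Finset.mul_sum, Finset.mul_sum]
    exact Finset.sum_le_sum fun c _ => hentry a c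
  -- pick a ξ at least as good as the average
  obtain ⟨ξ, _, hξ⟩ := Finset.exists_le_of_sum_le (Finset.univ_nonempty (α := Ξ))
    (f := fun _ : Ξ => s * ∑ a, ∑ c, if near a c ∧ lvl a c ≠ 1 then W a c else 0)
    (g := fun ξ => 2 * q * ∑ a, ∑ c, W a c * (u ξ a * v ξ c)) (by
      rw [Finset.sum_const, nsmul_eq_mul, Finset.card_univ, ← Finset.mul_sum]
      exact hG)
  exact ⟨u ξ, v ξ, hu0 ξ, hv0 ξ, hfeas ξ, hξ⟩

/-- The ratio form: if moreover `W ≤ 0` on near level-1 entries and `M ≤ M⁺` on near entries of level `≠ 1`, then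
`⟨W, M⟩ ≤ M⁺·Σ⁺`; with `hash_rectangle_cap` this is `B_W ≤ 2q·M⁺/s`. -/
theorem witness_value_le {Row Col : Type*} [Fintype Row] [Fintype Col]
    (M W : Row → Col → ℝ) (near : Row → Col → Prop) [∀ a c, Decidable (near a c)] (lvl : Row → Col → ℕ)
    {Mmax : ℝ} (hM0 : ∀ a c, 0 ≤ M a c) (hMmax : ∀ a c, near a c → lvl a c ≠ 1 → M a c ≤ Mmax)
    (hWfar : ∀ a c, ¬ near a c → W a c = 0) (hWneg : ∀ a c, near a c → lvl a c = 1 → W a c ≤ 0)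
    (hWpos : ∀ a c, near a c → lvl a c ≠ 1 → 0 ≤ W a c) :
    ∑ a, ∑ c, W a c * M a c ≤ Mmax * ∑ a, ∑ c, if near a c ∧ lvl a c ≠ 1 then W a c else 0 := by
  rw [Finset.mul_sum]
  refine Finset.sum_le_sum fun a _ => ?_
  rw [Finset.mul_sum]
  refine Finset.sum_le_sum fun c _ => ?_
  by_cases hn : near a c
  · by_cases hl : lvl a c ≠ 1
    · rw [if_pos ⟨hn, hl⟩, mul_comm]
      exact mul_le_mul_of_nonneg_right (hMmax a c hn hl) (hWpos a c hn hl)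
    · rw [if_neg (fun h => hl h.2), mul_zero]
      exact mul_nonpos_of_nonpos_of_nonneg (hWneg a c hn (not_not.1 hl)) (hM0 a c)
  · rw [if_neg (fun h => hn h.1), hWfar a c hn]; simp

/-! ### The linear hash family over `ℤ_q`: `H (ω, c₀) a ⇔ Σ_{x∈a} ω(x) = c₀` -/

variable {n : ℕ}

/-- the linear hash of a row -/
def hashOf {q : ℕ} (ω : Fin n → ZMod q) (a : Finset (Fin n)) : ZMod q := ∑ x ∈ a, ω x

theorem hashOf_add {q : ℕ} (ω ω' : Fin n → ZMod q) (a : Finset (Fin n)) :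
    hashOf (ω + ω') a = hashOf ω a + hashOf ω' a := by
  simp [hashOf, Finset.sum_add_distrib]

theorem hashOf_smul_single {q : ℕ} (x₀ : Fin n) (cst : ZMod q) (a : Finset (Fin n)) :
    hashOf (cst • (Pi.single x₀ (1 : ZMod q) : Fin n → ZMod q)) a = if x₀ ∈ a then cst else 0 := by
  simp only [hashOf, Pi.smul_apply, smul_eq_mul, Pi.single_apply, mul_ite, mul_one, mul_zero]
  exact Finset.sum_ite_eq' a x₀ (fun _ => cst)

/-- two indicator constraints on one free value: `Σ_{c₀} [x = c₀ ∧ y = c₀] = [x = y]` -/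
theorem sum_ite_and_eq {q : ℕ} [NeZero q] (x y : ZMod q) :
    ∑ c₀ : ZMod q, (if x = c₀ ∧ y = c₀ then (1 : ℕ) else 0) = if x = y then 1 else 0 := by
  by_cases hxy : x = y
  · subst hxy
    rw [if_pos rfl]
    have : ∀ c₀ : ZMod q, (x = c₀ ∧ x = c₀) = (x = c₀) := fun c₀ => propext ⟨fun h => h.1, fun h => ⟨h, h⟩⟩
    simp_rw [this]
    rw [Finset.sum_ite_eq]; simp
  · rw [if_neg hxy]
    refine Finset.sum_eq_zero fun c₀ _ => ?_
    rw [if_neg]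
    rintro ⟨rfl, rfl⟩; exact hxy rfl

/-- **One hash constraint:** `#{(ω, c₀) : Σ_{x∈a} ω(x) = c₀} · q = q^{n+1}` (for each `ω` exactly one `c₀`). -/
theorem hash_count_one {q : ℕ} [NeZero q] (a : Finset (Fin n)) :
    q * (Finset.univ.filter (fun ξ : (Fin n → ZMod q) × ZMod q => hashOf ξ.1 a = ξ.2)).card =
      Fintype.card ((Fin n → ZMod q) × ZMod q) := by
  rw [Finset.card_filter, Fintype.sum_prod_type]
  simp only [Finset.sum_ite_eq, Finset.mem_univ, if_true, Finset.sum_const, Finset.card_univ, smul_eq_mul, mul_one,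
    Fintype.card_prod, ZMod.card]
  ring

/-- all fibres of the difference form `φ(ω) = Σ_{a} ω − Σ_{a′} ω` have the same size when `a ≠ a′` (translate along a
coordinate in the symmetric difference, where `φ` has coefficient `±1`). -/
theorem card_fibre_hashDiff_eq {q : ℕ} [NeZero q] {a a' : Finset (Fin n)} (haa : a ≠ a') (d : ZMod q) :
    (Finset.univ.filter (fun ω : Fin n → ZMod q => hashOf ω a - hashOf ω a' = d)).card =
      (Finset.univ.filter (fun ω : Fin n → ZMod q => hashOf ω a - hashOf ω a' = 0)).card := by
  -- a coordinate where the form has coefficient ±1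
  have hx : ∃ x₀, (x₀ ∈ a ∧ x₀ ∉ a') ∨ (x₀ ∈ a' ∧ x₀ ∉ a) := by
    by_contra hne
    apply haa
    ext x
    simp only [not_exists, not_or, not_and, not_not] at hne
    exact ⟨fun hx => (hne x).1 hx, fun hx' => (hne x).2 hx'⟩
  obtain ⟨x₀, hx₀⟩ := hx
  let ε : ZMod q := if x₀ ∈ a then 1 else -1
  let e : Fin n → ZMod q := Pi.single x₀ 1
  have hφe : ∀ cst : ZMod q, hashOf (cst • e) a - hashOf (cst • e) a' = cst * ε := by
    intro cst
    rw [hashOf_smul_single, hashOf_smul_single]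
    rcases hx₀ with ⟨h1, h2⟩ | ⟨h1, h2⟩
    · simp [ε, h1, h2]
    · simp [ε, h1, h2]
  have hε2 : ε * ε = 1 := by
    rcases hx₀ with ⟨h1, _⟩ | ⟨_, h2⟩
    · simp [ε, h1]
    · simp [ε, h2]
  -- translation ω ↦ ω - (ε d) • e maps the fibre over d onto the fibre over 0
  symm
  refine Finset.card_bij (fun ω _ => ω + (ε * d) • e) ?_ ?_ ?_
  · intro ω hω
    rw [mem_filter] at hω ⊢
    refine ⟨mem_univ _, ?_⟩
    rw [hashOf_add, hashOf_add, add_sub_add_comm, hω.2, hφe, zero_add, mul_assoc, mul_comm d ε, ← mul_assoc, hε2,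
      one_mul]
  · intro ω₁ _ ω₂ _ h
    exact add_right_cancel h
  · intro ω' hω'
    rw [mem_filter] at hω'
    refine ⟨ω' - (ε * d) • e, ?_, by simp⟩
    rw [mem_filter]
    refine ⟨mem_univ _, ?_⟩
    have h1 : hashOf ω' a - hashOf ω' a' = (hashOf (ω' - (ε * d) • e) a - hashOf (ω' - (ε * d) • e) a') +
        (hashOf ((ε * d) • e) a - hashOf ((ε * d) • e) a') := by
      rw [← add_sub_add_comm, ← hashOf_add, ← hashOf_add, sub_add_cancel]
    rw [hω'.2, hφe, mul_assoc, mul_comm d ε, ← mul_assoc, hε2, one_mul] at h1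
    -- h1 : d = X + d
    have := h1
    linear_combination -this

/-- **Two hash constraints on distinct rows:** `#{(ω,c₀) : hash a = c₀ = hash a′} · q² = q^{n+1}`. -/
theorem hash_count_two {q : ℕ} [NeZero q] {a a' : Finset (Fin n)} (haa : a ≠ a') :
    q ^ 2 * (Finset.univ.filter
        (fun ξ : (Fin n → ZMod q) × ZMod q => hashOf ξ.1 a = ξ.2 ∧ hashOf ξ.1 a' = ξ.2)).card =
      Fintype.card ((Fin n → ZMod q) × ZMod q) := by
  rw [Finset.card_filter, Fintype.sum_prod_type]
  simp only [sum_ite_and_eq]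
  -- Σ_ω [hash a = hash a'] = #fibre over 0 of the difference form
  have hfib : ∑ ω : Fin n → ZMod q, (if hashOf ω a = hashOf ω a' then 1 else 0) =
      (Finset.univ.filter (fun ω : Fin n → ZMod q => hashOf ω a - hashOf ω a' = 0)).card := by
    rw [Finset.card_filter]
    refine Finset.sum_congr rfl fun ω _ => ?_
    simp only [sub_eq_zero]
  rw [hfib]
  -- all q fibres have this size and partition the q^n functions
  have hpart : ∑ d : ZMod q, (Finset.univ.filter (fun ω : Fin n → ZMod q => hashOf ω a - hashOf ω a' = d)).card =
      (Finset.univ : Finset (Fin n → ZMod q)).card :=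
    (Finset.card_eq_sum_card_fiberwise (fun ω _ => Finset.mem_univ (hashOf ω a - hashOf ω a'))).symm
  simp_rw [card_fibre_hashDiff_eq haa] at hpart
  rw [Finset.sum_const, Finset.card_univ, ZMod.card, smul_eq_mul] at hpart
  rw [Fintype.card_prod, ZMod.card, Fintype.card_pi, Finset.prod_const, ZMod.card, Finset.card_univ, Fintype.card_fin]
  rw [Finset.card_univ, Fintype.card_pi, Finset.prod_const, ZMod.card, Finset.card_univ, Fintype.card_fin] at hpart
  rw [sq, mul_assoc, hpart]
  ring


/-! ### The pencil instance: CLASS-D witnesses on the slice `k` are capped independently of `n` -/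

theorem inv_nonneg (a : Finset (Fin n)) (π : Equiv.Perm (Fin n)) : (0 : ℤ) ≤ inv a π := by
  rw [inv_eq_card_invPairs]; exact Nat.cast_nonneg _

theorem one_le_sq_one_sub_of_ne_one {t : ℕ} (ht : t ≠ 1) : (1 : ℝ) ≤ (1 - (t : ℝ)) ^ 2 := by
  rcases Nat.lt_or_ge t 1 with h | h
  · have : t = 0 := by omega
    subst this; norm_num
  · have h2 : (2 : ℝ) ≤ t := by exact_mod_cast (show 2 ≤ t by omega)
    nlinarith

/-- **PROPOSITION H (kernel).**  On the slice `|a| = k ≤ n` of the located pencil `M_λ` (`λ ≥ 0`), with budget `w` (near ⇔ `inv ≤ w`)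
and any modulus `q ≥ 2((w+1)^{√w})²`: for EVERY weight `W` on slice-rows × columns vanishing off the near entries and nonnegative on the
near entries of intersection level `≠ 1` (CLASS D; its values on near level-1 entries are arbitrary), some hash rectangle
`u vᵀ ≤ M_λ` (`u = s·1{Σ_{x∈a} ω(x) = c₀}`, `v = 1{no near level-1 row of the column is hit}`, `s = min(1, λ(w+1))`) has
`s·Σ⁺ ≤ 2q·⟨W, u vᵀ⟩`, `Σ⁺ = Σ_{near, level ≠ 1} W`.  With `witness_value_le` (`⟨W,M⟩ ≤ M⁺Σ⁺`, `M⁺` = max entry on `supp W` at level `≠ 1`,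
`≤ (√w−1)² + λw` on the canonical clusters, `≤ n²` always): the hyperplane bound of every CLASS-D witness is `≤ 2q·M⁺/s = 2^{O(√w·log w)}`
(times at most `n²`) for `w ≥ 1/λ − 1` — no `n^{f(λ)}`.  (T2/T3 are CLASS D.) -/
theorem located_disjointness_witness_cap (k w q : ℕ) [NeZero q] (hkn : k ≤ n)
    (hqN : 2 * ((w + 1) ^ Nat.sqrt w) ^ 2 ≤ q) {lam : ℝ} (hlam : 0 ≤ lam)
    (W : {a : Finset (Fin n) // a.card = k} → Finset (Fin n) × Equiv.Perm (Fin n) → ℝ)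
    (hWfar : ∀ a c, ¬ (inv a.1 c.2 ≤ w) → W a c = 0)
    (hWpos : ∀ a c, inv a.1 c.2 ≤ w → (a.1 ∩ c.1).card ≠ 1 → 0 ≤ W a c) :
    ∃ (u : {a : Finset (Fin n) // a.card = k} → ℝ) (v : Finset (Fin n) × Equiv.Perm (Fin n) → ℝ),
      (∀ a, 0 ≤ u a) ∧ (∀ c, 0 ≤ v c) ∧ (∀ a c, u a * v c ≤ pencilEntry n lam a.1 c) ∧
      min 1 (lam * (w + 1)) * (∑ a, ∑ c, if inv a.1 c.2 ≤ w ∧ (a.1 ∩ c.1).card ≠ 1 then W a c else 0) ≤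
        2 * q * ∑ a, ∑ c, W a c * (u a * v c) := by
  classical
  have hq : 0 < q := Nat.pos_of_ne_zero (NeZero.ne q)
  refine hash_rectangle_cap (Ξ := (Fin n → ZMod q) × ZMod q) (pencilEntry n lam ∘ Subtype.val) W
    (fun a c => inv a.1 c.2 ≤ (w : ℤ)) (fun a c => (a.1 ∩ c.1).card)
    (fun ξ a => hashOf ξ.1 a.1 = ξ.2) hq hqN (s := min 1 (lam * (w + 1)))
    (le_min zero_le_one (mul_nonneg hlam (by positivity))) ?_ ?_ ?_ ?_ ?_ hWfar hWpos
  · -- M ≥ 0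
    intro a c
    simp only [Function.comp, pencilEntry]
    have h1 := sq_nonneg ((1 : ℝ) - ((a.1 ∩ c.1).card : ℝ))
    have h2 : (0 : ℝ) ≤ (inv a.1 c.2 : ℝ) := by exact_mod_cast inv_nonneg a.1 c.2
    nlinarith [mul_nonneg hlam h2]
  · -- M ≥ s off the near level-1 entries
    intro a c h
    simp only [Function.comp, pencilEntry]
    have h2 : (0 : ℝ) ≤ (inv a.1 c.2 : ℝ) := by exact_mod_cast inv_nonneg a.1 c.2
    by_cases hn : inv a.1 c.2 ≤ (w : ℤ)
    · have hsq := one_le_sq_one_sub_of_ne_one (h hn)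
      have := min_le_left (1 : ℝ) (lam * (w + 1))
      nlinarith [mul_nonneg hlam h2]
    · have hfar : ((w : ℝ) + 1) ≤ (inv a.1 c.2 : ℝ) := by
        have : (w : ℤ) + 1 ≤ inv a.1 c.2 := by omega
        exact_mod_cast this
      have := min_le_right (1 : ℝ) (lam * (w + 1))
      have hsq := sq_nonneg ((1 : ℝ) - ((a.1 ∩ c.1).card : ℝ))
      nlinarith [mul_le_mul_of_nonneg_left hfar hlam]
  · -- one hash constraint
    intro a
    have := hash_count_one (q := q) a.1
    have h' : (Fintype.card ((Fin n → ZMod q) × ZMod q) : ℝ) =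
        q * ((Finset.univ.filter (fun ξ : (Fin n → ZMod q) × ZMod q => hashOf ξ.1 a.1 = ξ.2)).card : ℝ) := by
      exact_mod_cast this.symm
    exact h'.le
  · -- two hash constraints
    intro a a' haa
    have hne : a.1 ≠ a'.1 := fun h => haa (Subtype.ext h)
    have := hash_count_two (q := q) hne
    have h' : (q : ℝ) ^ 2 * ((Finset.univ.filter (fun ξ : (Fin n → ZMod q) × ZMod q =>
        hashOf ξ.1 a.1 = ξ.2 ∧ hashOf ξ.1 a'.1 = ξ.2)).card : ℝ) = Fintype.card ((Fin n → ZMod q) × ZMod q) := by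
      exact_mod_cast this
    exact h'.le
  · -- the located neighbourhood bound (K3)
    intro c
    calc (Finset.univ.filter (fun a : {a : Finset (Fin n) // a.card = k} =>
            inv a.1 c.2 ≤ (w : ℤ) ∧ (a.1 ∩ c.1).card = 1)).card
        ≤ ((Finset.univ : Finset (Finset (Fin n))).filter (fun a => a.card = k ∧ inv a c.2 ≤ w)).card := by
          refine Finset.card_le_card_of_injOn Subtype.val ?_ ?_
          · intro a ha
            rw [Finset.mem_coe, mem_filter] at ha
            rw [Finset.mem_coe, mem_filter]
            exact ⟨mem_univ _, a.2, ha.2.1⟩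
          · intro a _ a' _ h
            exact Subtype.ext h
      _ ≤ ((w + 1) ^ Nat.sqrt w) ^ 2 := card_informative_rows_le c.2 hkn w

/-! ### PROPOSITION H′: EVERY near-supported witness is capped (any sign pattern) — hash × carrier rectangles -/

/-- **Abstract hash × carrier cap.**  A fixed nonnegative carrier rectangle `u₀ v₀ᵀ`, feasible (`≤ M`) outside an exclusion relation
`X` with at most `N ≤ q/2` excluded rows per column, and `W·u₀v₀ ≥ 0` outside `X`; a pairwise-good hash family.  Then the hashed
carrier `u = u₀·1{H ξ ·}`, `v = v₀·1{no excluded row hit}` is feasible for some `ξ` and earns `Σ_{¬X} W u₀ v₀ ≤ 2q·⟨W, u vᵀ⟩`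
(excluded entries — in particular all negative ones — are never touched). -/
theorem hash_carrier_cap {Row Col Ξ : Type*} [Fintype Row] [DecidableEq Row] [Fintype Col] [Fintype Ξ] [Nonempty Ξ]
    (M W : Row → Col → ℝ) (X : Row → Col → Prop) [∀ a c, Decidable (X a c)]
    (u₀ : Row → ℝ) (v₀ : Col → ℝ) (hu₀ : ∀ a, 0 ≤ u₀ a) (hv₀ : ∀ c, 0 ≤ v₀ c)
    (H : Ξ → Row → Prop) [∀ ξ a, Decidable (H ξ a)] {q N : ℕ} (hq : 0 < q) (hqN : 2 * N ≤ q)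
    (hM0 : ∀ a c, 0 ≤ M a c) (hM : ∀ a c, ¬ X a c → u₀ a * v₀ c ≤ M a c)
    (hH1 : ∀ a, (Fintype.card Ξ : ℝ) ≤ q * ((Finset.univ.filter (fun ξ => H ξ a)).card : ℝ))
    (hH2 : ∀ a a', a ≠ a' →
      (q : ℝ) ^ 2 * ((Finset.univ.filter (fun ξ => H ξ a ∧ H ξ a')).card : ℝ) ≤ Fintype.card Ξ)
    (hN : ∀ c, (Finset.univ.filter (fun a => X a c)).card ≤ N)
    (hWX : ∀ a c, ¬ X a c → 0 ≤ W a c * (u₀ a * v₀ c)) :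
    ∃ (u : Row → ℝ) (v : Col → ℝ), (∀ a, 0 ≤ u a) ∧ (∀ c, 0 ≤ v c) ∧ (∀ a c, u a * v c ≤ M a c) ∧
      (∑ a, ∑ c, if X a c then 0 else W a c * (u₀ a * v₀ c)) ≤ 2 * q * ∑ a, ∑ c, W a c * (u a * v c) := by
  classical
  let B : Ξ → Col → Prop := fun ξ c => ∀ a', X a' c → ¬ H ξ a'
  let u : Ξ → Row → ℝ := fun ξ a => if H ξ a then u₀ a else 0
  let v : Ξ → Col → ℝ := fun ξ c => if B ξ c then v₀ c else 0
  have hu0 : ∀ ξ a, 0 ≤ u ξ a := fun ξ a => by simp only [u]; split_ifs <;> simp [hu₀]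
  have hv0 : ∀ ξ c, 0 ≤ v ξ c := fun ξ c => by simp only [v]; split_ifs <;> simp [hv₀]
  have huv : ∀ ξ a c, u ξ a * v ξ c = if H ξ a ∧ B ξ c then u₀ a * v₀ c else 0 := by
    intro ξ a c; simp only [u, v]; split_ifs <;> simp_all
  have hfeas : ∀ ξ a c, u ξ a * v ξ c ≤ M a c := by
    intro ξ a c
    rw [huv]
    split_ifs with h
    · exact hM a c fun hX => h.2 a hX h.1
    · exact hM0 a c
  have hK : ∀ a c, ¬ X a c →
      (Fintype.card Ξ : ℝ) ≤ 2 * q * ((Finset.univ.filter (fun ξ => H ξ a ∧ B ξ c)).card : ℝ) := by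
    intro a c hX
    set Xc := Finset.univ.filter (fun a' => X a' c) with hXc
    have hcover : Finset.univ.filter (fun ξ => H ξ a) ⊆
        Finset.univ.filter (fun ξ => H ξ a ∧ B ξ c) ∪
          Xc.biUnion (fun a' => Finset.univ.filter (fun ξ => H ξ a ∧ H ξ a')) := by
      intro ξ hξ
      rw [mem_filter] at hξ
      rw [Finset.mem_union, mem_filter, Finset.mem_biUnion]
      by_cases hB : B ξ c
      · exact Or.inl ⟨mem_univ _, hξ.2, hB⟩
      · right
        simp only [B, not_forall, not_not, exists_prop] at hB
        obtain ⟨a', ha'X, ha'H⟩ := hB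
        exact ⟨a', mem_filter.2 ⟨mem_univ _, ha'X⟩, mem_filter.2 ⟨mem_univ _, hξ.2, ha'H⟩⟩
    have h1 : ((Finset.univ.filter (fun ξ => H ξ a)).card : ℝ) ≤
        ((Finset.univ.filter (fun ξ => H ξ a ∧ B ξ c)).card : ℝ) +
          ∑ a' ∈ Xc, ((Finset.univ.filter (fun ξ => H ξ a ∧ H ξ a')).card : ℝ) := by
      have := (card_le_card hcover).trans
        ((Finset.card_union_le _ _).trans (Nat.add_le_add_left Finset.card_biUnion_le _))
      exact_mod_cast this
    have h2 : ∀ a' ∈ Xc, (q : ℝ) ^ 2 * ((Finset.univ.filter (fun ξ => H ξ a ∧ H ξ a')).card : ℝ) ≤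
        Fintype.card Ξ := by
      intro a' ha'
      refine hH2 a a' fun h => hX ?_
      rw [h]; exact (mem_filter.1 ha').2
    have h3 : (q : ℝ) ^ 2 * ∑ a' ∈ Xc, ((Finset.univ.filter (fun ξ => H ξ a ∧ H ξ a')).card : ℝ) ≤
        Xc.card * Fintype.card Ξ := by
      rw [Finset.mul_sum]
      have := Finset.sum_le_sum h2
      simpa using this
    have hqr : (0 : ℝ) < q := by exact_mod_cast hq
    have hNc : (Xc.card : ℝ) * 2 ≤ q := by
      have := hN c; rw [← hXc] at this
      have : (Xc.card : ℝ) ≤ N := by exact_mod_cast this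
      have hqN' : (2 * N : ℝ) ≤ q := by exact_mod_cast hqN
      linarith
    have hX1 := hH1 a
    have hcardnn : (0 : ℝ) ≤ Fintype.card Ξ := Nat.cast_nonneg _
    nlinarith [h1, h3, hNc, hX1, hqr, hcardnn,
      mul_nonneg hqr.le (Nat.cast_nonneg (Finset.univ.filter (fun ξ => H ξ a ∧ B ξ c)).card)]
  have hentry : ∀ a c, (Fintype.card Ξ : ℝ) * (if X a c then 0 else W a c * (u₀ a * v₀ c)) ≤
      2 * q * ∑ ξ, W a c * (u ξ a * v ξ c) := by
    intro a c
    have hcount : ∑ ξ, W a c * (u ξ a * v ξ c) =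
        W a c * (u₀ a * v₀ c) * ((Finset.univ.filter (fun ξ => H ξ a ∧ B ξ c)).card : ℝ) := by
      simp only [huv]
      rw [← Finset.mul_sum, Finset.sum_ite, Finset.sum_const_zero, add_zero, Finset.sum_const, nsmul_eq_mul]
      ring
    rw [hcount]
    by_cases hX : X a c
    · rw [if_pos hX]
      have hempty : Finset.univ.filter (fun ξ => H ξ a ∧ B ξ c) = ∅ := by
        rw [Finset.filter_eq_empty_iff]
        intro ξ _ h
        exact h.2 a hX h.1
      rw [hempty]; simp
    · rw [if_neg hX]
      have hKac := hK a c hX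
      have hW := hWX a c hX
      nlinarith
  have hG : (Fintype.card Ξ : ℝ) * (∑ a, ∑ c, if X a c then 0 else W a c * (u₀ a * v₀ c)) ≤
      2 * q * ∑ ξ, ∑ a, ∑ c, W a c * (u ξ a * v ξ c) := by
    have hcomm : ∑ ξ, ∑ a, ∑ c, W a c * (u ξ a * v ξ c) = ∑ a, ∑ c, ∑ ξ, W a c * (u ξ a * v ξ c) := by
      rw [Finset.sum_comm]
      exact Finset.sum_congr rfl fun a _ => Finset.sum_comm
    rw [hcomm, Finset.mul_sum, Finset.mul_sum]
    refine Finset.sum_le_sum fun a _ => ?_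
    rw [Finset.mul_sum, Finset.mul_sum]
    exact Finset.sum_le_sum fun c _ => hentry a c
  obtain ⟨ξ, _, hξ⟩ := Finset.exists_le_of_sum_le (Finset.univ_nonempty (α := Ξ))
    (f := fun _ : Ξ => ∑ a, ∑ c, if X a c then 0 else W a c * (u₀ a * v₀ c))
    (g := fun ξ => 2 * q * ∑ a, ∑ c, W a c * (u ξ a * v ξ c)) (by
      rw [Finset.sum_const, nsmul_eq_mul, Finset.card_univ, ← Finset.mul_sum]
      exact hG)
  exact ⟨u ξ, v ξ, hu0 ξ, hv0 ξ, hfeas ξ, hξ⟩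

/-- bookkeeping for `located_witness_cap`: two capped parts add up to a cap by the better rectangle -/
theorem cap_combine {s q N2 crd S₁ SQ SL TT Tp A Bv : ℝ} (hq : 0 ≤ q) (hN2 : 0 ≤ N2)
    (hr₁ : S₁ ≤ 2 * q * A) (hr₂ : Tp ≤ 2 * q * Bv) (hp : TT ≤ crd * Tp) (hcrd : crd ≤ N2) (hTp : 0 ≤ Tp)
    (hQ : s * SQ ≤ N2 * S₁) (hL : s * SL ≤ TT) :
    s * (SQ + SL) ≤ 4 * q * N2 * max A Bv := by
  have h2 : N2 * S₁ ≤ N2 * (2 * q * A) := mul_le_mul_of_nonneg_left hr₁ hN2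
  have h3 : TT ≤ N2 * (2 * q * Bv) :=
    hp.trans ((mul_le_mul_of_nonneg_right hcrd hTp).trans (mul_le_mul_of_nonneg_left hr₂ hN2))
  have hqN : 0 ≤ 2 * q * N2 := by positivity
  have h4 : 2 * q * N2 * A ≤ 2 * q * N2 * max A Bv := mul_le_mul_of_nonneg_left (le_max_left A Bv) hqN
  have h5 : 2 * q * N2 * Bv ≤ 2 * q * N2 * max A Bv := mul_le_mul_of_nonneg_left (le_max_right A Bv) hqN
  nlinarith [hQ, hL, h2, h3, h4, h5]

/-- **PROPOSITION H″ (kernel, REV 3): a hyperplane witness that is NONNEGATIVE on the far entries is capped — whatever it does on the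
near entries.**  Same data as `located_witness_cap` below, but the support hypothesis `W = 0` off the near entries `inv ≤ w` is weakened to
`0 ≤ W` there: positive far mass is caught by the same hashed carriers (the unit carrier is feasible on far entries since `M ≥ λ(w+1) ≥ s`
there, and far rows are never excluded), so it is a reward like any near positive entry.  Consequence (the word «negative» of memo §2 (C3) in
kernel): an `n^{f(λ)}` hyperplane lower bound for the located pencil REQUIRES NEGATIVE MASS ON FAR ENTRIES. -/
theorem farNonneg_witness_cap (k w q : ℕ) [NeZero q] (hn : 0 < n) (hkn : k ≤ n)
    (hqN : 2 * ((w + 1) ^ Nat.sqrt w) ^ 2 ≤ q) {lam : ℝ} (hlam : 0 ≤ lam)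
    (W : {a : Finset (Fin n) // a.card = k} → Finset (Fin n) × Equiv.Perm (Fin n) → ℝ)
    (hWfar : ∀ a c, ¬ (inv a.1 c.2 ≤ w) → 0 ≤ W a c) :
    ∃ (u : {a : Finset (Fin n) // a.card = k} → ℝ) (v : Finset (Fin n) × Equiv.Perm (Fin n) → ℝ),
      (∀ a, 0 ≤ u a) ∧ (∀ c, 0 ≤ v c) ∧ (∀ a c, u a * v c ≤ pencilEntry n lam a.1 c) ∧
      min 1 (lam * (w + 1)) * (∑ a, ∑ c, W a c * pencilEntry n lam a.1 c) ≤
        4 * q * ((n : ℝ) + 1) ^ 2 * ∑ a, ∑ c, W a c * (u a * v c) := by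
  classical
  set s := min 1 (lam * (w + 1)) with hs_def
  have hs0 : 0 ≤ s := le_min zero_le_one (mul_nonneg hlam (by positivity))
  have hs1 : s ≤ 1 := min_le_left _ _
  have hq : 0 < q := Nat.pos_of_ne_zero (NeZero.ne q)
  have hqr : (0 : ℝ) < q := by exact_mod_cast hq
  -- shared facts about the pencil and the hash family
  have hinv0 : ∀ (a : {a : Finset (Fin n) // a.card = k}) (c : Finset (Fin n) × Equiv.Perm (Fin n)),
      (0 : ℝ) ≤ (inv a.1 c.2 : ℝ) := fun a c => by exact_mod_cast inv_nonneg a.1 c.2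
  have hQle : ∀ (a : {a : Finset (Fin n) // a.card = k}) (c : Finset (Fin n) × Equiv.Perm (Fin n)),
      ((1 : ℝ) - ((a.1 ∩ c.1).card : ℝ)) ^ 2 ≤ ((n : ℝ) + 1) ^ 2 := by
    intro a c
    have ht : ((a.1 ∩ c.1).card : ℝ) ≤ n := by
      have := (Finset.card_le_univ (a.1 ∩ c.1)); rw [Fintype.card_fin] at this
      exact_mod_cast this
    have ht0 : (0 : ℝ) ≤ ((a.1 ∩ c.1).card : ℝ) := Nat.cast_nonneg _
    nlinarith
  have hM0 : ∀ (a : {a : Finset (Fin n) // a.card = k}) (c : Finset (Fin n) × Equiv.Perm (Fin n)),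
      0 ≤ pencilEntry n lam a.1 c := by
    intro a c
    simp only [pencilEntry]
    nlinarith [sq_nonneg ((1 : ℝ) - ((a.1 ∩ c.1).card : ℝ)), mul_nonneg hlam (hinv0 a c)]
  have hH1 : ∀ a : {a : Finset (Fin n) // a.card = k}, (Fintype.card ((Fin n → ZMod q) × ZMod q) : ℝ) ≤
      q * ((Finset.univ.filter (fun ξ : (Fin n → ZMod q) × ZMod q => hashOf ξ.1 a.1 = ξ.2)).card : ℝ) := by
    intro a
    have := hash_count_one (q := q) a.1
    have h' : (Fintype.card ((Fin n → ZMod q) × ZMod q) : ℝ) =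
        q * ((Finset.univ.filter (fun ξ : (Fin n → ZMod q) × ZMod q => hashOf ξ.1 a.1 = ξ.2)).card : ℝ) := by
      exact_mod_cast this.symm
    exact h'.le
  have hH2 : ∀ a a' : {a : Finset (Fin n) // a.card = k}, a ≠ a' →
      (q : ℝ) ^ 2 * ((Finset.univ.filter (fun ξ : (Fin n → ZMod q) × ZMod q =>
        hashOf ξ.1 a.1 = ξ.2 ∧ hashOf ξ.1 a'.1 = ξ.2)).card : ℝ) ≤ Fintype.card ((Fin n → ZMod q) × ZMod q) := by
    intro a a' haa
    have hne : a.1 ≠ a'.1 := fun h => haa (Subtype.ext h)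
    have := hash_count_two (q := q) hne
    have h' : (q : ℝ) ^ 2 * ((Finset.univ.filter (fun ξ : (Fin n → ZMod q) × ZMod q =>
        hashOf ξ.1 a.1 = ξ.2 ∧ hashOf ξ.1 a'.1 = ξ.2)).card : ℝ) = Fintype.card ((Fin n → ZMod q) × ZMod q) := by
      exact_mod_cast this
    exact h'.le
  have hnearN : ∀ c : Finset (Fin n) × Equiv.Perm (Fin n),
      (Finset.univ.filter (fun a : {a : Finset (Fin n) // a.card = k} => inv a.1 c.2 ≤ (w : ℤ))).card ≤
        ((w + 1) ^ Nat.sqrt w) ^ 2 := by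
    intro c
    calc (Finset.univ.filter (fun a : {a : Finset (Fin n) // a.card = k} => inv a.1 c.2 ≤ (w : ℤ))).card
        ≤ ((Finset.univ : Finset (Finset (Fin n))).filter (fun a => a.card = k ∧ inv a c.2 ≤ w)).card := by
          refine Finset.card_le_card_of_injOn Subtype.val ?_ ?_
          · intro a ha
            rw [Finset.mem_coe, mem_filter] at ha
            rw [Finset.mem_coe, mem_filter]
            exact ⟨mem_univ _, a.2, ha.2⟩
          · intro a _ a' _ h
            exact Subtype.ext h
      _ ≤ ((w + 1) ^ Nat.sqrt w) ^ 2 := card_informative_rows_le c.2 hkn w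
  -- RECTANGLE 1: hashed unit carrier, excluding level-1 and negative near rows
  let X₁ : {a : Finset (Fin n) // a.card = k} → Finset (Fin n) × Equiv.Perm (Fin n) → Prop :=
    fun a c => inv a.1 c.2 ≤ (w : ℤ) ∧ ((a.1 ∩ c.1).card = 1 ∨ W a c < 0)
  have hside_f1 : ∀ a c, ¬ X₁ a c → (fun _ : {a : Finset (Fin n) // a.card = k} => s) a *
      (fun _ : Finset (Fin n) × Equiv.Perm (Fin n) => (1 : ℝ)) c ≤ (pencilEntry n lam ∘ Subtype.val) a c := by
    intro a c hX
    simp only [Function.comp, pencilEntry, mul_one]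
    by_cases hn' : inv a.1 c.2 ≤ (w : ℤ)
    · have hl : (a.1 ∩ c.1).card ≠ 1 := fun h => hX ⟨hn', Or.inl h⟩
      have hsq := one_le_sq_one_sub_of_ne_one hl
      nlinarith [mul_nonneg hlam (hinv0 a c)]
    · have hfar : ((w : ℝ) + 1) ≤ (inv a.1 c.2 : ℝ) := by
        have : (w : ℤ) + 1 ≤ inv a.1 c.2 := by omega
        exact_mod_cast this
      have := min_le_right (1 : ℝ) (lam * (w + 1))
      nlinarith [mul_le_mul_of_nonneg_left hfar hlam, sq_nonneg ((1 : ℝ) - ((a.1 ∩ c.1).card : ℝ))]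
  have hside_n1 : ∀ c, (Finset.univ.filter (fun a => X₁ a c)).card ≤ ((w + 1) ^ Nat.sqrt w) ^ 2 := by
    intro c
    refine (Finset.card_le_card ?_).trans (hnearN c)
    intro a ha
    rw [mem_filter] at ha ⊢
    exact ⟨ha.1, ha.2.1⟩
  have hside_w1 : ∀ a c, ¬ X₁ a c → 0 ≤ W a c * ((fun _ : {a : Finset (Fin n) // a.card = k} => s) a *
      (fun _ : Finset (Fin n) × Equiv.Perm (Fin n) => (1 : ℝ)) c) := by
    intro a c hX
    by_cases hn' : inv a.1 c.2 ≤ (w : ℤ)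
    · have hW : 0 ≤ W a c := by
        by_contra h
        exact hX ⟨hn', Or.inr (lt_of_not_ge h)⟩
      exact mul_nonneg hW (mul_nonneg hs0 zero_le_one)
    · exact mul_nonneg (hWfar a c hn') (mul_nonneg hs0 zero_le_one)
  obtain ⟨u₁, v₁, hu₁, hv₁, hf₁, hr₁⟩ := hash_carrier_cap (Ξ := (Fin n → ZMod q) × ZMod q)
    (pencilEntry n lam ∘ Subtype.val) W X₁ (fun _ => s) (fun _ => (1 : ℝ)) (fun _ => hs0) (fun _ => zero_le_one)
    (fun ξ a => hashOf ξ.1 a.1 = ξ.2) hq hqN hM0 hside_f1 hH1 hH2 hside_n1 hside_w1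
  -- RECTANGLE 2 (one per inversion pair p = (l, l′)): hashed inversion carrier, excluding negative near rows
  let X₂ : {a : Finset (Fin n) // a.card = k} → Finset (Fin n) × Equiv.Perm (Fin n) → Prop :=
    fun a c => inv a.1 c.2 ≤ (w : ℤ) ∧ W a c < 0
  let cu : Fin n × Fin n → {a : Finset (Fin n) // a.card = k} → ℝ :=
    fun p a => lam * ((ind a.1 p.1 : ℝ) * (1 - (ind a.1 p.2 : ℝ)))
  let cv : Fin n × Fin n → Finset (Fin n) × Equiv.Perm (Fin n) → ℝ := fun p c => (invInd c.2 p.1 p.2 : ℝ)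
  have hcu : ∀ p a, 0 ≤ cu p a := by
    intro p a
    have h1 : (0 : ℝ) ≤ (ind a.1 p.1 : ℝ) := by exact_mod_cast ind_nonneg a.1 p.1
    have h2 : (ind a.1 p.2 : ℝ) ≤ 1 := by exact_mod_cast ind_le_one a.1 p.2
    exact mul_nonneg hlam (mul_nonneg h1 (by linarith))
  have hcv : ∀ p c, 0 ≤ cv p c := fun p c => by
    simp only [cv]; exact_mod_cast invInd_nonneg c.2 p.1 p.2
  have hterm_le : ∀ p a c, cu p a * cv p c ≤ lam * (inv a.1 c.2 : ℝ) := by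
    intro p a c
    simp only [cu, cv]
    rw [inv_cast_sum, mul_assoc]
    refine mul_le_mul_of_nonneg_left ?_ hlam
    refine Finset.single_le_sum (f := fun p' : Fin n × Fin n =>
        ((ind a.1 p'.1 : ℝ) * (1 - (ind a.1 p'.2 : ℝ))) * (invInd c.2 p'.1 p'.2 : ℝ)) ?_ (mem_univ p)
    intro p' _
    have h1 : (0 : ℝ) ≤ (ind a.1 p'.1 : ℝ) := by exact_mod_cast ind_nonneg a.1 p'.1
    have h2 : (ind a.1 p'.2 : ℝ) ≤ 1 := by exact_mod_cast ind_le_one a.1 p'.2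
    have h3 : (0 : ℝ) ≤ (invInd c.2 p'.1 p'.2 : ℝ) := by exact_mod_cast invInd_nonneg c.2 p'.1 p'.2
    exact mul_nonneg (mul_nonneg h1 (by linarith)) h3
  have hR2 : ∀ p : Fin n × Fin n, ∃ (u : {a : Finset (Fin n) // a.card = k} → ℝ)
      (v : Finset (Fin n) × Equiv.Perm (Fin n) → ℝ),
      (∀ a, 0 ≤ u a) ∧ (∀ c, 0 ≤ v c) ∧ (∀ a c, u a * v c ≤ (pencilEntry n lam ∘ Subtype.val) a c) ∧
      (∑ a, ∑ c, if X₂ a c then 0 else W a c * (cu p a * cv p c)) ≤ 2 * q * ∑ a, ∑ c, W a c * (u a * v c) := by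
    intro p
    refine hash_carrier_cap (Ξ := (Fin n → ZMod q) × ZMod q) (pencilEntry n lam ∘ Subtype.val) W X₂ (cu p) (cv p)
      (hcu p) (hcv p) (fun ξ a => hashOf ξ.1 a.1 = ξ.2) hq hqN hM0 ?_ hH1 hH2 ?_ ?_
    · intro a c _
      simp only [Function.comp, pencilEntry]
      nlinarith [hterm_le p a c, sq_nonneg ((1 : ℝ) - ((a.1 ∩ c.1).card : ℝ))]
    · intro c
      refine (Finset.card_le_card ?_).trans (hnearN c)
      intro a ha
      rw [mem_filter] at ha ⊢
      exact ⟨ha.1, ha.2.1⟩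
    · intro a c hX
      by_cases hn' : inv a.1 c.2 ≤ (w : ℤ)
      · have hW : 0 ≤ W a c := by
          by_contra h
          exact hX ⟨hn', lt_of_not_ge h⟩
        exact mul_nonneg hW (mul_nonneg (hcu p a) (hcv p c))
      · exact mul_nonneg (hWfar a c hn') (mul_nonneg (hcu p a) (hcv p c))
  choose u₂ v₂ hu₂ hv₂ hf₂ hr₂ using hR2
  -- the located part summed over the pairs is `Σ_{¬X₂} W·λ·inv`
  let T : Fin n × Fin n → ℝ := fun p => ∑ a, ∑ c, if X₂ a c then 0 else W a c * (cu p a * cv p c)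
  have hTsum : ∑ p, T p = ∑ a, ∑ c, if X₂ a c then 0 else W a c * (lam * (inv a.1 c.2 : ℝ)) := by
    simp only [T]
    rw [Finset.sum_comm]
    refine Finset.sum_congr rfl fun a _ => ?_
    rw [Finset.sum_comm]
    refine Finset.sum_congr rfl fun c _ => ?_
    by_cases hX : X₂ a c
    · simp [hX]
    · simp only [if_neg hX]
      rw [← Finset.mul_sum, inv_cast_sum, Finset.mul_sum, Finset.mul_sum, Finset.mul_sum]
      refine Finset.sum_congr rfl fun p _ => ?_
      simp only [cu, cv]; ring
  -- pigeonhole over the n² pairs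
  haveI : Nonempty (Fin n × Fin n) := ⟨(⟨0, hn⟩, ⟨0, hn⟩)⟩
  obtain ⟨p₀, _, hp₀⟩ := Finset.exists_le_of_sum_le (Finset.univ_nonempty (α := Fin n × Fin n))
    (f := fun _ : Fin n × Fin n => ∑ p, T p) (g := fun p => (Fintype.card (Fin n × Fin n) : ℝ) * T p) (by
      rw [Finset.sum_const, nsmul_eq_mul, Finset.card_univ, ← Finset.mul_sum])
  have hcardp : (Fintype.card (Fin n × Fin n) : ℝ) ≤ ((n : ℝ) + 1) ^ 2 := by
    rw [Fintype.card_prod, Fintype.card_fin]; push_cast; nlinarith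
  -- (i) the quadratic part against rectangle 1
  have hQpart : s * ∑ a, ∑ c, W a c * ((1 : ℝ) - ((a.1 ∩ c.1).card : ℝ)) ^ 2 ≤
      ((n : ℝ) + 1) ^ 2 * ∑ a, ∑ c, (if X₁ a c then 0 else W a c * (s * 1)) := by
    rw [Finset.mul_sum, Finset.mul_sum]
    refine Finset.sum_le_sum fun a _ => ?_
    rw [Finset.mul_sum, Finset.mul_sum]
    refine Finset.sum_le_sum fun c _ => ?_
    have hQ0 := sq_nonneg ((1 : ℝ) - ((a.1 ∩ c.1).card : ℝ))
    by_cases hX : X₁ a c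
    · rw [if_pos hX, mul_zero]
      rcases hX.2 with h1 | hneg
      · rw [h1]; simp
      · nlinarith [mul_nonneg hs0 hQ0]
    · rw [if_neg hX]
      by_cases hn' : inv a.1 c.2 ≤ (w : ℤ)
      · have hW : 0 ≤ W a c := by
          by_contra h
          exact hX ⟨hn', Or.inr (lt_of_not_ge h)⟩
        nlinarith [hQle a c, mul_nonneg hW hs0, mul_nonneg (mul_nonneg hW hs0) hQ0]
      · have hW := hWfar a c hn'
        nlinarith [hQle a c, mul_nonneg hW hs0, mul_nonneg (mul_nonneg hW hs0) hQ0]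
  -- (ii) the located part against the T-sum
  have hLpart : s * ∑ a, ∑ c, W a c * (lam * (inv a.1 c.2 : ℝ)) ≤ ∑ p, T p := by
    rw [hTsum, Finset.mul_sum]
    refine Finset.sum_le_sum fun a _ => ?_
    rw [Finset.mul_sum]
    refine Finset.sum_le_sum fun c _ => ?_
    have hL0 : 0 ≤ lam * (inv a.1 c.2 : ℝ) := mul_nonneg hlam (hinv0 a c)
    by_cases hX : X₂ a c
    · rw [if_pos hX]
      nlinarith [mul_nonneg hs0 hL0, hX.2]
    · rw [if_neg hX]
      by_cases hn' : inv a.1 c.2 ≤ (w : ℤ)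
      · have hW : 0 ≤ W a c := by
          by_contra h
          exact hX ⟨hn', lt_of_not_ge h⟩
        nlinarith [mul_nonneg hW hL0]
      · have hW := hWfar a c hn'
        nlinarith [mul_nonneg hW hL0]
  -- combine
  have hsplit : ∑ a, ∑ c, W a c * pencilEntry n lam a.1 c =
      ∑ a, ∑ c, W a c * ((1 : ℝ) - ((a.1 ∩ c.1).card : ℝ)) ^ 2 + ∑ a, ∑ c, W a c * (lam * (inv a.1 c.2 : ℝ)) := by
    rw [← Finset.sum_add_distrib]
    refine Finset.sum_congr rfl fun a _ => ?_
    rw [← Finset.sum_add_distrib]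
    refine Finset.sum_congr rfl fun c _ => ?_
    simp only [pencilEntry]; ring
  have hT0' : 0 ≤ T p₀ := by
    simp only [T]
    refine Finset.sum_nonneg fun a _ => Finset.sum_nonneg fun c _ => ?_
    by_cases hX : X₂ a c
    · simp [hX]
    · rw [if_neg hX]
      by_cases hn' : inv a.1 c.2 ≤ (w : ℤ)
      · have hW : 0 ≤ W a c := by
          by_contra h
          exact hX ⟨hn', lt_of_not_ge h⟩
        exact mul_nonneg hW (mul_nonneg (hcu p₀ a) (hcv p₀ c))
      · exact mul_nonneg (hWfar a c hn') (mul_nonneg (hcu p₀ a) (hcv p₀ c))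
  have hmain := cap_combine (s := s) hqr.le (sq_nonneg ((n : ℝ) + 1)) hr₁ (hr₂ p₀) hp₀ hcardp hT0' hQpart hLpart
  rw [← hsplit] at hmain
  -- choose the better of the two rectangles
  rcases le_total (∑ a, ∑ c, W a c * (u₁ a * v₁ c)) (∑ a, ∑ c, W a c * (u₂ p₀ a * v₂ p₀ c)) with hcmp | hcmp
  · refine ⟨u₂ p₀, v₂ p₀, hu₂ p₀, hv₂ p₀, hf₂ p₀, ?_⟩
    rwa [max_eq_right hcmp] at hmain
  · refine ⟨u₁, v₁, hu₁, hv₁, hf₁, ?_⟩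
    rwa [max_eq_left hcmp] at hmain

/-- **PROPOSITION H′ (kernel): EVERY hyperplane witness supported on the near entries of a slice is capped — whatever its sign
pattern across intersection levels.**  Slice `|a| = k ≤ n` (`0 < n`), budget `w`, `λ ≥ 0`, modulus `q ≥ 2((w+1)^{√w})²`; `W` any real
weight on slice-rows × columns with `W = 0` off the near entries `inv ≤ w`.  Then some feasible rectangle `u vᵀ ≤ M_λ` has
`s·⟨W, M_λ⟩ ≤ 4q(n+1)²·⟨W, u vᵀ⟩`, `s = min(1, λ(w+1))`: the hyperplane bound of `W` is `≤ 4q(n+1)²/s = poly(n)·2^{O(√w log w)}` —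
no `n^{f(λ)}`.  The rectangle is either the hashed unit carrier (excluding columns with a hit level-1 or negative near row; pays the
`(1−t)²` part) or a hashed INVERSION carrier `λ[l∈a][l′∉a] ⊗ [π(l′)<π(l)]` (excluding columns with a hit negative row; pays the flood part
`λ·inv`, which is an `n²`-slot cone term, §2).  Consequence for the window: located (near-supported) hyperplane witnesses are EXACTLY
T3-strength; an `n^{f(λ)}` lower bound needs NEGATIVE mass on FAR entries (`inv > w`) — PROPOSITION H″ `farNonneg_witness_cap` above, of which
this is the special case `W = 0` off the near entries — or a non-hyperplane argument (memo §2). -/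
theorem located_witness_cap (k w q : ℕ) [NeZero q] (hn : 0 < n) (hkn : k ≤ n)
    (hqN : 2 * ((w + 1) ^ Nat.sqrt w) ^ 2 ≤ q) {lam : ℝ} (hlam : 0 ≤ lam)
    (W : {a : Finset (Fin n) // a.card = k} → Finset (Fin n) × Equiv.Perm (Fin n) → ℝ)
    (hWfar : ∀ a c, ¬ (inv a.1 c.2 ≤ w) → W a c = 0) :
    ∃ (u : {a : Finset (Fin n) // a.card = k} → ℝ) (v : Finset (Fin n) × Equiv.Perm (Fin n) → ℝ),
      (∀ a, 0 ≤ u a) ∧ (∀ c, 0 ≤ v c) ∧ (∀ a c, u a * v c ≤ pencilEntry n lam a.1 c) ∧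
      min 1 (lam * (w + 1)) * (∑ a, ∑ c, W a c * pencilEntry n lam a.1 c) ≤
        4 * q * ((n : ℝ) + 1) ^ 2 * ∑ a, ∑ c, W a c * (u a * v c) :=
  farNonneg_witness_cap k w q hn hkn hqN hlam W (fun a c h => (hWfar a c h).symm.le)

end HashCap

/-! ## §5  The position quotient (memo rev 4, R1): the slice is the `S_n`-unfolding of ONE permutation-free matrix

`M_λ[a;(b,π)] = M̄_{λ,k}(π a, π b)` with `M̄_{λ,k}(A,B) = (1 − |A∩B|)² + λ·(ΣA − k(k−1)/2)` on `k`-subsets `A` of positions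
`{0,…,n−1}` and `B ⊆ {0,…,n−1}`: the block `π = id` of the slice IS `M̄`, every other block is `M̄` relabelled.  Hence every
lower bound for `M̄` (`rank₊`, rectangle LP, fooling sets) is one for the pencil, and `rank₊ M̄ ≤ rank₊(M_λ|_k) ≤` T1. -/

section Quotient

variable {n : ℕ}

open Summit.ValiantsHypothesis.Theorems.NNDivisionHardNegative.WeakReliefBlind (posLT card_posLT)

/-- trichotomy of positions: for every ordered pair exactly one of `π l′ < π l`, `π l < π l′`, `l = l′`. -/
theorem invInd_add_invInd_add_ite (π : Equiv.Perm (Fin n)) (l l' : Fin n) :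
    invInd π l l' + invInd π l' l + (if l = l' then 1 else 0) = 1 := by
  unfold invInd
  by_cases h : l = l'
  · subst h; simp
  · have hne : π l ≠ π l' := fun e => h (π.injective e)
    rcases lt_or_gt_of_ne hne with hlt | hgt
    · simp [hlt, not_lt.2 hlt.le, h]
    · simp [hgt, not_lt.2 hgt.le, h]

/-- Within a row `a`, the ordered pairs `(l, l′) ∈ a × a` with `π l′ < π l` number `|a|(|a|−1)/2`:
`2 · Σ_{l,l′ ∈ a} [π l′ < π l] = |a|² − |a|`. -/
theorem two_mul_sum_invInd (a : Finset (Fin n)) (π : Equiv.Perm (Fin n)) :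
    2 * (∑ l ∈ a, ∑ l' ∈ a, invInd π l l') = (a.card : ℤ) * a.card - a.card := by
  have hsym : ∑ l ∈ a, ∑ l' ∈ a, invInd π l' l = ∑ l ∈ a, ∑ l' ∈ a, invInd π l l' := Finset.sum_comm
  have hdiag : ∑ l ∈ a, ∑ l' ∈ a, (if l = l' then (1 : ℤ) else 0) = a.card := by
    have : ∀ l ∈ a, ∑ l' ∈ a, (if l = l' then (1 : ℤ) else 0) = 1 := fun l hl => by
      rw [Finset.sum_ite_eq]; simp [hl]
    rw [Finset.sum_congr rfl this]; simp
  have htot : ∑ l ∈ a, ∑ l' ∈ a, (invInd π l l' + invInd π l' l + (if l = l' then (1 : ℤ) else 0)) =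
      (a.card : ℤ) * a.card := by
    rw [Finset.sum_congr rfl fun l _ => Finset.sum_congr rfl fun l' _ => invInd_add_invInd_add_ite π l l']
    simp only [Finset.sum_const, nsmul_eq_mul, mul_one]
  rw [Finset.sum_congr rfl fun l _ => (Finset.sum_add_distrib (s := a)
      (f := fun l' => invInd π l l' + invInd π l' l) (g := fun l' => if l = l' then (1 : ℤ) else 0)),
    Finset.sum_add_distrib, hdiag,
    Finset.sum_congr rfl fun l _ => (Finset.sum_add_distrib (s := a)
      (f := fun l' => invInd π l l') (g := fun l' => invInd π l' l)),
    Finset.sum_add_distrib, hsym] at htot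
  linarith

/-- all positions below `π l`: `Σ_{l′} [π l′ < π l] = π(l)`. -/
theorem sum_invInd_eq_pos (π : Equiv.Perm (Fin n)) (l : Fin n) :
    ∑ l', invInd π l l' = ((π l : ℕ) : ℤ) := by
  unfold invInd
  rw [Finset.sum_boole]
  have hset : (Finset.univ.filter fun l' : Fin n => π l' < π l) = posLT π (π l : ℕ) := by
    ext l'; rw [Finset.mem_filter, mem_posLT_iff, Fin.lt_def]; simp
  rw [hset, card_posLT π (le_of_lt (π l).isLt)]

/-- **Position-sum formula for the flood.**  `inv(a;π) = Σ_{l ∈ a} π(l) − |a|(|a|−1)/2`: the flood of a row is the sum of the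
positions of its elements minus the least possible such sum (attained only at the located base `P_k(π)`). -/
theorem two_mul_inv_eq (a : Finset (Fin n)) (π : Equiv.Perm (Fin n)) :
    2 * inv a π = 2 * (∑ l ∈ a, ((π l : ℕ) : ℤ)) - ((a.card : ℤ) * a.card - a.card) := by
  have hin : ∀ l, ∑ l' ∈ a, invInd π l l' = ∑ l', ind a l' * invInd π l l' := by
    intro l
    rw [← Finset.sum_subset (f := fun l' => ind a l' * invInd π l l') (Finset.subset_univ a)
      (fun l' _ hl' => by simp [ind, hl'])]
    exact Finset.sum_congr rfl fun l' hl' => by simp [ind, hl']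
  have h1 : inv a π = ∑ l ∈ a, (∑ l', invInd π l l' - ∑ l' ∈ a, invInd π l l') := by
    unfold inv
    rw [← Finset.sum_subset (f := fun l => ∑ l', ind a l * (1 - ind a l') * invInd π l l') (Finset.subset_univ a)
      (fun l _ hl => by simp [ind, hl])]
    refine Finset.sum_congr rfl fun l hl => ?_
    rw [hin l, ← Finset.sum_sub_distrib]
    refine Finset.sum_congr rfl fun l' _ => ?_
    simp only [ind, if_pos hl, one_mul, sub_mul]
  rw [h1, Finset.sum_sub_distrib, ← two_mul_sum_invInd a π, mul_sub,
    Finset.sum_congr rfl fun l _ => sum_invInd_eq_pos π l]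

/-- the same over `ℝ`, on the slice `|a| = k`: `inv(a;π) = Σ_{l∈a} π(l) − k(k−1)/2`. -/
theorem inv_eq_sum_pos {k : ℕ} {a : Finset (Fin n)} (hak : a.card = k) (π : Equiv.Perm (Fin n)) :
    (inv a π : ℝ) = (∑ l ∈ a, ((π l : ℕ) : ℝ)) - (k : ℝ) * (k - 1) / 2 := by
  have h := two_mul_inv_eq a π
  rw [hak] at h
  have h' : ((2 * inv a π : ℤ) : ℝ) = ((2 * (∑ l ∈ a, ((π l : ℕ) : ℤ)) - ((k : ℤ) * k - k) : ℤ) : ℝ) := by rw [h]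
  push_cast at h'
  linear_combination (1 / 2 : ℝ) * h'

/-- **The reduced matrix `M̄_{λ,k}`** on positions: `(1 − |A∩B|)² + λ·(ΣA − k(k−1)/2)`. -/
noncomputable def pencilBar (n : ℕ) (lam : ℝ) (k : ℕ) (A B : Finset (Fin n)) : ℝ :=
  (1 - ((A ∩ B).card : ℝ)) ^ 2 + lam * ((∑ p ∈ A, ((p : ℕ) : ℝ)) - (k : ℝ) * (k - 1) / 2)

/-- **R1 — the position quotient.**  `M_λ[a;(b,π)] = M̄_{λ,k}(π a, π b)`: the pencil entry depends on `(a, b, π)` only through the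
position sets `π(a), π(b)`; in particular the block `π = id` of the slice is `M̄_{λ,k}` itself (`pencil_block_one`) and the slice is
the `S_n`-unfolding of `M̄_{λ,k}` (rows shared, one relabelled copy of `M̄` per `π`). -/
theorem pencil_quotient (lam : ℝ) {k : ℕ} {a : Finset (Fin n)} (hak : a.card = k) (b : Finset (Fin n))
    (π : Equiv.Perm (Fin n)) :
    pencilEntry n lam a (b, π) = pencilBar n lam k (a.map π.toEmbedding) (b.map π.toEmbedding) := by
  unfold pencilEntry pencilBar
  rw [← Finset.map_inter, Finset.card_map, Finset.sum_map, inv_eq_sum_pos hak π]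
  rfl

/-- the block `π = 1` of the slice is `M̄_{λ,k}` verbatim. -/
theorem pencil_block_one (lam : ℝ) {k : ℕ} {a : Finset (Fin n)} (hak : a.card = k) (b : Finset (Fin n)) :
    pencilEntry n lam a (b, 1) = pencilBar n lam k a b := by
  rw [pencil_quotient lam hak b 1]
  show pencilBar n lam k (a.map (Function.Embedding.refl _)) (b.map (Function.Embedding.refl _)) = _
  rw [Finset.map_refl, Finset.map_refl]

/-- every block is the block `1` relabelled: `M_λ[a;(b,π)] = M_λ[π a;(π b, 1)]`. -/
theorem pencil_block_relabel (lam : ℝ) (a b : Finset (Fin n)) (π : Equiv.Perm (Fin n)) :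
    pencilEntry n lam a (b, π) = pencilEntry n lam (a.map π.toEmbedding) (b.map π.toEmbedding, 1) := by
  rw [pencil_quotient lam rfl b π, pencil_block_one lam (by rw [Finset.card_map])]

/-- **`S_n`-invariance of the pencil** (the symmetry behind R1/R2): relabelling rows and columns by `σ` and the arrival order by
`π ∘ σ⁻¹` does not change the entry. -/
theorem pencil_invariant (lam : ℝ) (a b : Finset (Fin n)) (π σ : Equiv.Perm (Fin n)) :
    pencilEntry n lam (a.map σ.toEmbedding) (b.map σ.toEmbedding, π * σ⁻¹) = pencilEntry n lam a (b, π) := by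
  have hemb : σ.toEmbedding.trans (π * σ⁻¹).toEmbedding = π.toEmbedding := by
    ext x; simp
  rw [pencil_block_relabel lam _ _ (π * σ⁻¹), pencil_block_relabel lam a b π, Finset.map_map, Finset.map_map, hemb]

/-- **Every lower bound for `M̄` is one for the pencil (factorisation form).**  A nonnegative factorisation of the slice of `M_λ`
through `S` restricts, on the block `π = 1`, to one of `M̄_{λ,k}` through the same `S`. -/
theorem pencilBar_factorization_of_pencil (lam : ℝ) (k : ℕ) {S : Type*} [Fintype S]
    (U : {a : Finset (Fin n) // a.card = k} → S → ℝ) (V : Finset (Fin n) × Equiv.Perm (Fin n) → S → ℝ)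
    (hU : ∀ a s, 0 ≤ U a s) (hV : ∀ c s, 0 ≤ V c s)
    (hUV : ∀ a c, pencilEntry n lam a.1 c = ∑ s, U a s * V c s) :
    ∃ (U' : {a : Finset (Fin n) // a.card = k} → S → ℝ) (V' : Finset (Fin n) → S → ℝ),
      (∀ a s, 0 ≤ U' a s) ∧ (∀ b s, 0 ≤ V' b s) ∧ ∀ a b, pencilBar n lam k a.1 b = ∑ s, U' a s * V' b s :=
  ⟨U, fun b => V (b, 1), hU, fun b => hV (b, 1), fun a b => by rw [← pencil_block_one lam a.2 b]; exact hUV a (b, 1)⟩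

end Quotient

end Summit.ValiantsHypothesis.ValiantsHypothesis.Cruxes.NNDivisionHard.AsymmetricWindow39
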